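import Literature.AlgebraicGeometry.Motives.HodgeThetaSubalgebraUnitaryOrthogonalChainPos
import Literature.AlgebraicGeometry.Motives.HodgeThetaSubalgebraUnitaryFortyOneFortyThreeGoodRankCores
import Literature.AlgebraicGeometry.Motives.HodgeThetaSubalgebraUnitaryTwentySixTwentySevenCore
import Literature.AlgebraicGeometry.Motives.HodgeThetaSubalgebraUnitaryTwentyThirtyNineCore
import Literature.AlgebraicGeometry.Motives.HodgeThetaSubalgebraUnitaryThirtyTwoThirtyFiveCorePart2
import HarnessLib
import Literature.AlgebraicGeometry.Motives.HodgeThetaSubalgebraUnitaryConstantRankLeviThree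
import Literature.AlgebraicGeometry.Motives.HodgeThetaSubalgebraUnitaryFiveCoreAll
import Literature.AlgebraicGeometry.Motives.HodgeThetaSubalgebraUnitaryNineElevenCore
import Literature.AlgebraicGeometry.Motives.HodgeThetaSubalgebraUnitarySixSevenCoreAll
import Literature.AlgebraicGeometry.Motives.HodgeThetaSubalgebraUnitaryThreeCoprimeCore
import Literature.AlgebraicGeometry.Motives.HodgeThetaSubalgebraUnitaryTwelveThirteenCore

/-!
# (Part 3 of 3 — lemmas) The `Θ`-subalgebra theorem for unitary multiplicities `(32, 35)` — a `p = 67` cell by minimal-rank base points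
# and sub-Levi recursion (Ribet 1983 Thm. 3, Lie step; abelian 67-folds of type `(32, 35)`)

Family `hodge`, layer `Literature/AlgebraicGeometry/Motives` (pure linear algebra over `ℂ`; no geometry). Research
context: cell `pub-hodge-ring2` (HONEST FRAMING: research route conditional on HC_CM; not a corollary; Q11.4-sentence-2
already refuted in dim ≥ 3), Literature lane gen 89. UNCONDITIONAL; theorems only, no definition, no named fact
(D-0026), no `sorry`.

THE PRINT. K. A. Ribet, Amer. J. Math. 105 (1983), Thm. 3 = Gordon's survey Thm. 6.3 (3) [held
`paper:arxiv-alg-geom_9709030` p. 18]. THE METHOD: `HodgeThetaSubalgebraUnitarySixteenTwentyOneCore` (a raising operator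
`B` of MINIMAL non-zero rank `m`, the profile dichotomy `i + j ≤ m` or `i, j ≥ m`, tree cores making a Levi algebra full
or killing a Levi rank, lifts `UnitaryRaisingSpace.exists_raise_finrank_range_eq` + `UnitaryLeviSetup.exists_lift`, two
pencils `UnitaryGenericRank.exists_finrank_le_and_finrank_le`, the non-vanishing lemma
`UnitaryLeviFull.exists_raise_commute_apply_ne_zero`, TOOL C `UnitaryConstantRank.exists_raise_rank_ne_two`, TOOL F
`UnitaryConstantRank.false_of_le_rank`), the full-rank chain `UnitaryConstantRank.dvd_of_rank_eq_finrank`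
(`HodgeThetaSubalgebraUnitaryNineTwentyEightCore`) and TOOL G `UnitaryOrthogonalChain.false_of_constProfile`.

THIS PART FILE holds minimal-rank lemmas of the cell (the gate caps a proposal at 200 kB); the core theorem `UnitaryThirtyTwoThirtyFive.eq_top_of_smul` is assembled in `HodgeThetaSubalgebraUnitaryThirtyTwoThirtyFiveCore`.

THE CELL `(32 | 35)`. Good ranks 1, 2, 3, 4, 6, 11, 13, 22, 24, 29, 31, 32 (Levi types `(1|34)`, `(2|33)`, `(3|32)`, `(4|31)`, `(6|29)`, `(11|24)`, `(13|22)`, `(22|13)`, `(24|11)`, `(29|6)`, `(31|4)`, `(32|3)` are tree cores); a proper `𝔊` has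
raising ranks in `{0, 5, 7, 8, 9, 10, 12, 14, 15, 16, 17, 18, 19, 20, 21, 23, 25, 26, 27, 28, 30}`; `m` minimal non-zero, `B` of rank `m`; a commuting raising `X` has profile
`(i, j)` (`i + j` a raising rank, `i + j ≤ m` or `i, j ≥ m`). SUB-LEVI RECURSION: when the non-zero profiles are constantly
`(i, j)`, the Levi algebra `L⁺` (resp. `L⁻`) is a `Θ`-algebra whose non-zero raising ranks are all `i` (resp. `j`), and the
same minimal-rank analysis applies to it (the `sub…` lemmas of §1).
* `m = 5` (`U⁺` of type `(27 | 5)`, `U⁻` of type `(5 | 30)`): `L⁺` of type `(27 | 5)` is full and a lift with `i = 4` has `j ∈ {1}`, killed in `L⁻` (type `(5 | 30)`).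
* `m = 7` (`U⁺` of type `(25 | 7)`, `U⁻` of type `(7 | 28)`): `L⁺` of type `(25 | 7)` is full and a lift with `i = 2` has `j ∈ {5}`, killed in `L⁻` (type `(7 | 28)`).
* `m = 8` (`U⁺` of type `(24 | 8)`, `U⁻` of type `(8 | 27)`): the non-zero profiles [(2, 6), (8, 0)] are pairwise exclusive, so constant; `(2, 6)`: TOOL C on `L⁺`; `(8, 0)`: `L⁻` would kill `Q ∩ ker B`.
* `m = 9` (`U⁺` of type `(23 | 9)`, `U⁻` of type `(9 | 26)`): after the Levi kills every profile has `i = 0` (profiles [(0, 0)]), against the non-vanishing lemma.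
* `m = 10` (`U⁺` of type `(22 | 10)`, `U⁻` of type `(10 | 25)`): after the Levi kills the profiles are [(0, 0), (0, 10), (10, 0), (10, 10)], so `L⁺` (type `(22 | 10)`) is a `Θ`-algebra with non-zero raising ranks in `{10}` — impossible by the sub-Levi lemmas.
* `m = 12` (`U⁺` of type `(20 | 12)`, `U⁻` of type `(12 | 23)`): after the Levi kills every profile has `i = 0` (profiles [(0, 0)]), against the non-vanishing lemma.
* `m = 14` (`U⁺` of type `(18 | 14)`, `U⁻` of type `(14 | 21)`): after the Levi kills the profiles are [(0, 0), (0, 14), (2, 12), (8, 6), (14, 0), (14, 14)], so `L⁺` (type `(18 | 14)`) is a `Θ`-algebra with non-zero raising ranks in `{2, 8, 14}` — impossible by the sub-Levi lemmas.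
* `m = 15` (`U⁺` of type `(17 | 15)`, `U⁻` of type `(15 | 20)`): `L⁺` of type `(17 | 15)` is full and a lift with `i = 2` has `j ∈ {13}`, killed in `L⁻` (type `(15 | 20)`).
* `m = 16` (`U⁺` of type `(16 | 16)`, `U⁻` of type `(16 | 19)`): after the Levi kills every profile has `j = 0` (profiles [(0, 0), (16, 0)]), against the non-vanishing lemma on `U⁻`.
* `m = 17` (`U⁺` of type `(15 | 17)`, `U⁻` of type `(17 | 18)`): `L⁺` of type `(15 | 17)` is full and a lift with `i = 4` has `j ∈ {13}`, killed in `L⁻` (type `(17 | 18)`).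
* `m = 18` (`U⁺` of type `(14 | 18)`, `U⁻` of type `(18 | 17)`): the non-zero profiles [(2, 16), (3, 15), (4, 14), (6, 12), (8, 10), (9, 9), (10, 8), (12, 6), (14, 4)] are pairwise exclusive, so constant; `(2, 16)`: TOOL C on `L⁺`; `(3, 15)`: `L⁺` (type `(14 | 18)`) has constant rank `3`; `(4, 14)`: `L⁺` (type `(14 | 18)`) has constant rank `4`; `(6, 12)`: `L⁺` (type `(14 | 18)`) has constant rank `6`; `(8, 10)`: `L⁺` (type `(14 | 18)`) has constant rank `8`; `(9, 9)`: `L⁺` (type `(14 | 18)`) has constant rank `9`; `(10, 8)`: TOOL G; `(12, 6)`: TOOL G; `(14, 4)`: TOOL G.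
* `m = 19` (`U⁺` of type `(13 | 19)`, `U⁻` of type `(19 | 16)`): `L⁺` of type `(13 | 19)` is full and a lift with `i = 1` has no feasible `j`.
* `m = 20` (`U⁺` of type `(12 | 20)`, `U⁻` of type `(20 | 15)`): the non-zero profiles [(5, 15), (6, 14), (8, 12), (10, 10), (12, 8)] are pairwise exclusive, so constant; `(5, 15)`: `L⁺` (type `(12 | 20)`) has constant rank `5`; `(6, 14)`: `L⁺` (type `(12 | 20)`) has constant rank `6`; `(8, 12)`: `L⁺` (type `(12 | 20)`) has constant rank `8`; `(10, 10)`: TOOL G; `(12, 8)`: TOOL G.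
* `m = 21` (`U⁺` of type `(11 | 21)`, `U⁻` of type `(21 | 14)`): `L⁺` of type `(11 | 21)` is full and a lift with `i = 1` has no feasible `j`.
* `m = 23` (`U⁺` of type `(9 | 23)`, `U⁻` of type `(23 | 12)`): after the Levi kills every profile has `i = 0` (profiles [(0, 0)]), against the non-vanishing lemma.
* `m = 25` (`U⁺` of type `(7 | 25)`, `U⁻` of type `(25 | 10)`): `L⁺` of type `(7 | 25)` is full and a lift with `i = 1` has no feasible `j`.
* `m = 26` (`U⁺` of type `(6 | 26)`, `U⁻` of type `(26 | 9)`): after the Levi kills every profile has `i = 0` (profiles [(0, 0)]), against the non-vanishing lemma.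
* `m = 27` (`U⁺` of type `(5 | 27)`, `U⁻` of type `(27 | 8)`): `L⁺` of type `(5 | 27)` is full and a lift with `i = 1` has no feasible `j`.
* `m = 28` (`U⁺` of type `(4 | 28)`, `U⁻` of type `(28 | 7)`): after the Levi kills every profile has `i = 0` (profiles [(0, 0)]), against the non-vanishing lemma.
* `m = 30` (`U⁺` of type `(2 | 30)`, `U⁻` of type `(30 | 5)`): after the Levi kills every profile has `i = 0` (profiles [(0, 0)]), against the non-vanishing lemma.

## References
* [Ribet1983] K. A. Ribet, *Hodge classes on certain types of abelian varieties*, Amer. J. Math. 105 (1983), Thm. 3.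
* [Gordon1997] B. B. Gordon, *A survey of the Hodge conjecture for abelian varieties*, Thm. 6.3 (3), pp. 18–19.
* [Deligne1982HodgeCycles] P. Deligne, *Hodge cycles on abelian varieties*, LNM 900 (1982), I §3 Prop. 3.4, 3.6.
* [GoodmanWallachGTM255] R. Goodman, N. R. Wallach, GTM 255 (2009), §2.3.1, §4.1.1.
* [HoffmanKunze1971LinearAlgebra] K. Hoffman, R. Kunze, *Linear Algebra* (1971), §3.1 Thm. 2, §6.7, §8.5.
-/

noncomputable section

open Module

namespace Literature.AlgebraicGeometry.Motives

namespace HodgeStructure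

universe u

variable {W : Type u} [AddCommGroup W] [Module ℂ W]

/-! ### §2 The minimal-rank lemmas -/

/-- `(32 | 35)`, minimal rank `18`: the non-zero profiles [(2, 16), (3, 15), (4, 14), (6, 12), (8, 10), (9, 9), (10, 8), (12, 6), (14, 4)] are pairwise exclusive, so constant; `(2, 16)`: TOOL C on `L⁺`; `(3, 15)`: `L⁺` (type `(14 | 18)`) has constant rank `3`; `(4, 14)`: `L⁺` (type `(14 | 18)`) has constant rank `4`; `(6, 12)`: `L⁺` (type `(14 | 18)`) has constant rank `6`; `(8, 10)`: `L⁺` (type `(14 | 18)`) has constant rank `8`; `(9, 9)`: `L⁺` (type `(14 | 18)`) has constant rank `9`; `(10, 8)`: TOOL G; `(12, 6)`: TOOL G; `(14, 4)`: TOOL G. [cite: Ribet1983, Thm. 3] [cite: Gordon1997, Thm. 6.3 (3)]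
[cite: Deligne1982HodgeCycles, I §3 Prop. 3.4, 3.6] [cite: GoodmanWallachGTM255, §4.1.1] -/
theorem UnitaryThirtyTwoThirtyFive.no_minRank_18 [FiniteDimensional ℂ W] {𝔊 : Submodule ℂ (Module.End ℂ W)}
    (hbr : ∀ Y ∈ 𝔊, ∀ Z ∈ 𝔊, Y * Z - Z * Y ∈ 𝔊)
    (hirr : ∀ U : Submodule ℂ W, (∀ A ∈ 𝔊, ∀ u ∈ U, A u ∈ U) → U = ⊥ ∨ U = ⊤)
    {Θ : Module.End ℂ W} (hΘ : Θ ∈ 𝔊) (hΘΘ : Θ * Θ = 1)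
    {P Q : Submodule ℂ W} (hP : ∀ x, x ∈ P ↔ Θ x = x) (hQ : ∀ x, x ∈ Q ↔ Θ x = -x)
    (hP32 : Module.finrank ℂ P = 32) (hQ35 : Module.finrank ℂ Q = 35)
    {s : W → W → ℂ} (hadd : ∀ x y z, s (x + y) z = s x z + s y z)
    (hsmul : ∀ (c : ℂ) (x y : W), s (c • x) y = c * s x y) (hsymm : ∀ x y, s y x = starRingEnd ℂ (s x y))
    (hPQ : ∀ p ∈ P, ∀ q ∈ Q, s p q = 0) (hdefP : ∀ p ∈ P, s p p = 0 → p = 0) (hdefQ : ∀ q ∈ Q, s q q = 0 → q = 0)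
    (hadj : ∀ X ∈ 𝔊, ∃ Y ∈ 𝔊, ∀ x y, s (X x) y = s x (Y y))
    (hS : ∀ B' ∈ 𝔊, Θ * B' = B' → B' * Θ = -B' →
      Module.finrank ℂ (LinearMap.range B') = 0 ∨ Module.finrank ℂ (LinearMap.range B') = 18 ∨ Module.finrank ℂ (LinearMap.range B') = 19 ∨ Module.finrank ℂ (LinearMap.range B') = 20 ∨ Module.finrank ℂ (LinearMap.range B') = 21 ∨ Module.finrank ℂ (LinearMap.range B') = 23 ∨ Module.finrank ℂ (LinearMap.range B') = 25 ∨ Module.finrank ℂ (LinearMap.range B') = 26 ∨ Module.finrank ℂ (LinearMap.range B') = 27 ∨ Module.finrank ℂ (LinearMap.range B') = 28 ∨ Module.finrank ℂ (LinearMap.range B') = 30)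
    {B : Module.End ℂ W} (hB : B ∈ 𝔊) (hΘB : Θ * B = B) (hBΘ : B * Θ = -B)
    (hr : Module.finrank ℂ (LinearMap.range B) = 18) : False := by
  classical
  have hsU : ∀ U : Submodule ℂ W, ∀ x y z : U, s ((x + y : U) : W) z = s (x : W) z + s (y : W) z :=
    fun U x y z => by simp only [Submodule.coe_add, hadd]
  have hsmU : ∀ U : Submodule ℂ W, ∀ (c : ℂ) (x y : U), s ((c • x : U) : W) y = c * s (x : W) y :=
    fun U c x y => by simp only [Submodule.coe_smul, hsmul]
  have hno1 : ∀ B' ∈ 𝔊, Θ * B' = B' → B' * Θ = -B' → Module.finrank ℂ (LinearMap.range B') ≠ 1 := by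
    intro B' hB' hΘB' hB'Θ h1
    rcases hS B' hB' hΘB' hB'Θ with h | h | h | h | h | h | h | h | h | h | h <;> omega
  have hmin : ∀ Y ∈ 𝔊, Θ * Y = Y → Y * Θ = -Y → Y ≠ 0 → 18 ≤ Module.finrank ℂ (LinearMap.range Y) := by
    intro Y hY hΘY hYΘ hY0
    have h0 : Module.finrank ℂ (LinearMap.range Y) ≠ 0 := fun h =>
      hY0 (LinearMap.range_eq_bot.1 (Submodule.finrank_eq_zero.1 h))
    rcases hS Y hY hΘY hYΘ with h | h | h | h | h | h | h | h | h | h | h <;> omega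
  have hmin' : ∀ Z ∈ 𝔊, Θ * Z = Z → Z * Θ = -Z → Z ≠ 0 → Module.finrank ℂ (LinearMap.range B) ≤ Module.finrank ℂ (LinearMap.range Z) := by
    rw [hr]; exact hmin
  obtain ⟨ι, Um, Up, PU, QU, Lm, ιm, Pm, Qm, Lp, ιp, Pp, Qp, hιmem, hιι, hιΘ, hιs, hUm, hUp, hfinUm, hfinUp,
    hPM, hQM, hPU, hQU, hrangeP, hPUP, hQUQ, hfinQM, hfinPU, hfinQU, hLm, hLp,
    hιmapply, hPmmem, hQmmem, hbrLm, hirrLm, hιmmem, hιmιm, hPm, hQm, hfinPm, hfinQm, hPmQm, hdefPm, hdefQm, hadjLm,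
    hιpapply, hPpmem, hQpmem, hbrLp, hirrLp, hιpmem, hιpιp, hPp, hQp, hfinPp, hfinQp, hPpQp, hdefPp, hdefQp, hadjLp,
    hsplit⟩ :=
    UnitaryLeviSetup.exists_levi_pair hbr hirr hΘ hΘΘ hP hQ hadd hsymm hPQ hdefP hdefQ hadj hB hΘB hBΘ
  have hdich : ∀ X ∈ 𝔊, Θ * X = X → X * Θ = -X → X * ι = ι * X →
      Module.finrank ℂ (Up.map X) + Module.finrank ℂ (Um.map X) ≤ Module.finrank ℂ (LinearMap.range B) ∨
        (18 ≤ Module.finrank ℂ (Up.map X) ∧ 18 ≤ Module.finrank ℂ (Um.map X)) := fun X hX hΘX hXΘ hXc =>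
    UnitaryLeviSetup.profile_dichotomy hbr hΘΘ hP hQ hadd hsymm hPQ hdefP hdefQ hadj hmin hB hΘB hBΘ hιι hιΘ hιs hUm hUp
      hPM hQM hQU hfinQU hrangeP hX hΘX hXΘ hXc
  have hfinQU' := hfinQU
  rw [hr] at hfinQM hfinPU hfinQU hfinPm hfinQm hfinPp hfinQp hsplit hdich
  rw [hQ35] at hfinQM hfinQm hfinUm
  rw [hP32] at hfinPU hfinPp hfinUp
  have hcm : ∀ Z : Module.End ℂ W, Z * ι = ι * Z → ∀ x ∈ Um, Z x ∈ Um := fun Z hZ x hx =>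
    (hUm _).2 (by rw [← Module.End.mul_apply, ← hZ, Module.End.mul_apply, (hUm x).1 hx, map_neg])
  have hcp : ∀ Z : Module.End ℂ W, Z * ι = ι * Z → ∀ x ∈ Up, Z x ∈ Up := fun Z hZ x hx =>
    (hUp _).2 (by rw [← Module.End.mul_apply, ← hZ, Module.End.mul_apply, (hUp x).1 hx])
  have hfullm_of : Lm = ⊤ → False := fun h =>
    UnitaryLeviSetup.false_of_full_larger hbr hΘΘ hno1 hιι hιΘ hUm hUp (by omega) (by omega) hPM hQM (by omega)
      (by omega) hLm h
  have hkillm5 : ∀ X ∈ 𝔊, Θ * X = X → X * Θ = -X → X * ι = ι * X → Module.finrank ℂ (Um.map X) ≠ 5 := by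
    intro X hX hΘX hXΘ hXc h5
    obtain ⟨hxmem, hιmx, hxιm, hxrk⟩ := UnitaryLeviSetup.restrict_mem hcm hLm hιmapply X hX hΘX hXΘ hXc
    rw [h5] at hxrk
    refine hfullm_of (UnitaryDoubleLevi.eq_top_of_raise_of_core' hbrLm hirrLm hιmmem hιmιm hPm hQm
      (s := fun v w : Um => s (v : W) w) (hsU Um) (fun v w => hsymm v w) hPmQm hdefPm hdefQm hadjLm hxmem hιmx hxιm
      (by rw [hxrk]; omega) (by omega) (by omega)
      fun U' 𝔩' ι' P' Q' hbr𝔩' hirr𝔩' hι' hι'ι' hP' hQ' hfinP' hfinQ' hP'Q' hdefP' hdefQ' hadj𝔩' => ?_)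
    rw [hxrk] at hfinP' hfinQ'
    exact UnitaryFive.eq_top_of_smul hbr𝔩' hirr𝔩' hι' hι'ι' hP' hQ' hfinP' (by omega) (s := fun x y : U' => s ((x : Um) : W) y) (fun x y z => by simp only [Submodule.coe_add, hadd]) (fun c x y => by simp only [Submodule.coe_smul, hsmul]) (fun x y => hsymm _ _) hP'Q' hdefP' hdefQ' hadj𝔩'
  have hkillm7 : ∀ X ∈ 𝔊, Θ * X = X → X * Θ = -X → X * ι = ι * X → Module.finrank ℂ (Um.map X) ≠ 7 := by
    intro X hX hΘX hXΘ hXc h7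
    obtain ⟨hxmem, hιmx, hxιm, hxrk⟩ := UnitaryLeviSetup.restrict_mem hcm hLm hιmapply X hX hΘX hXΘ hXc
    rw [h7] at hxrk
    refine hfullm_of (UnitaryDoubleLevi.eq_top_of_raise_of_core' hbrLm hirrLm hιmmem hιmιm hPm hQm
      (s := fun v w : Um => s (v : W) w) (hsU Um) (fun v w => hsymm v w) hPmQm hdefPm hdefQm hadjLm hxmem hιmx hxιm
      (by rw [hxrk]; omega) (by omega) (by omega)
      fun U' 𝔩' ι' P' Q' hbr𝔩' hirr𝔩' hι' hι'ι' hP' hQ' hfinP' hfinQ' hP'Q' hdefP' hdefQ' hadj𝔩' => ?_)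
    rw [hxrk] at hfinP' hfinQ'
    exact UnitarySeven.eq_top_of_smul hbr𝔩' hirr𝔩' hι' hι'ι' hP' hQ' hfinP' (by omega) (s := fun x y : U' => s ((x : Um) : W) y) (fun x y z => by simp only [Submodule.coe_add, hadd]) (fun c x y => by simp only [Submodule.coe_smul, hsmul]) (fun x y => hsymm _ _) hP'Q' hdefP' hdefQ' hadj𝔩'
  have hkillm11 : ∀ X ∈ 𝔊, Θ * X = X → X * Θ = -X → X * ι = ι * X → Module.finrank ℂ (Um.map X) ≠ 11 := by
    intro X hX hΘX hXΘ hXc h11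
    obtain ⟨hxmem, hιmx, hxιm, hxrk⟩ := UnitaryLeviSetup.restrict_mem hcm hLm hιmapply X hX hΘX hXΘ hXc
    rw [h11] at hxrk
    refine hfullm_of (UnitaryDoubleLevi.eq_top_of_raise_of_core' hbrLm hirrLm hιmmem hιmιm hPm hQm
      (s := fun v w : Um => s (v : W) w) (hsU Um) (fun v w => hsymm v w) hPmQm hdefPm hdefQm hadjLm hxmem hιmx hxιm
      (by rw [hxrk]; omega) (by omega) (by omega)
      fun U' 𝔩' ι' P' Q' hbr𝔩' hirr𝔩' hι' hι'ι' hP' hQ' hfinP' hfinQ' hP'Q' hdefP' hdefQ' hadj𝔩' => ?_)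
    rw [hxrk] at hfinP' hfinQ'
    exact UnitarySeven.eq_top_of_smul' hbr𝔩' hirr𝔩' hι' hι'ι' hP' hQ' (by omega) (by omega) (s := fun x y : U' => s ((x : Um) : W) y) (fun x y z => by simp only [Submodule.coe_add, hadd]) (fun c x y => by simp only [Submodule.coe_smul, hsmul]) (fun x y => hsymm _ _) hP'Q' hdefP' hdefQ' hadj𝔩'
  have hkillm13 : ∀ X ∈ 𝔊, Θ * X = X → X * Θ = -X → X * ι = ι * X → Module.finrank ℂ (Um.map X) ≠ 13 := by
    intro X hX hΘX hXΘ hXc h13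
    obtain ⟨hxmem, hιmx, hxιm, hxrk⟩ := UnitaryLeviSetup.restrict_mem hcm hLm hιmapply X hX hΘX hXΘ hXc
    rw [h13] at hxrk
    refine hfullm_of (UnitaryDoubleLevi.eq_top_of_raise_of_core' hbrLm hirrLm hιmmem hιmιm hPm hQm
      (s := fun v w : Um => s (v : W) w) (hsU Um) (fun v w => hsymm v w) hPmQm hdefPm hdefQm hadjLm hxmem hιmx hxιm
      (by rw [hxrk]; omega) (by omega) (by omega)
      fun U' 𝔩' ι' P' Q' hbr𝔩' hirr𝔩' hι' hι'ι' hP' hQ' hfinP' hfinQ' hP'Q' hdefP' hdefQ' hadj𝔩' => ?_)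
    rw [hxrk] at hfinP' hfinQ'
    exact UnitaryFive.eq_top_of_smul' hbr𝔩' hirr𝔩' hι' hι'ι' hP' hQ' (by omega) (by omega) (s := fun x y : U' => s ((x : Um) : W) y) (fun x y z => by simp only [Submodule.coe_add, hadd]) (fun c x y => by simp only [Submodule.coe_smul, hsmul]) (fun x y => hsymm _ _) hP'Q' hdefP' hdefQ' hadj𝔩'
  have hkillm17 : ∀ X ∈ 𝔊, Θ * X = X → X * Θ = -X → X * ι = ι * X → Module.finrank ℂ (Um.map X) ≠ 17 := by
    intro X hX hΘX hXΘ hXc h17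
    obtain ⟨hxmem, hιmx, hxιm, hxrk⟩ := UnitaryLeviSetup.restrict_mem hcm hLm hιmapply X hX hΘX hXΘ hXc
    rw [h17] at hxrk
    refine hfullm_of (UnitaryDoubleLevi.eq_top_of_raise_of_core' hbrLm hirrLm hιmmem hιmιm hPm hQm
      (s := fun v w : Um => s (v : W) w) (hsU Um) (fun v w => hsymm v w) hPmQm hdefPm hdefQm hadjLm hxmem hιmx hxιm
      (by rw [hxrk]; omega) (by omega) (by omega)
      fun U' 𝔩' ι' P' Q' hbr𝔩' hirr𝔩' hι' hι'ι' hP' hQ' hfinP' hfinQ' hP'Q' hdefP' hdefQ' hadj𝔩' => ?_)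
    rw [hxrk] at hfinP' hfinQ'
    exact UnitaryThreeCoprime.eq_top_of_finrank_eq_one hbr𝔩' hirr𝔩' hι' hι'ι' hP' hQ' (by omega) (by omega)
  have hfullp_of : Lp = ⊤ → False := by
    intro hLptop
    obtain ⟨T1, hιT1, hT1ι, hT1r⟩ := UnitaryRaisingSpace.exists_raise_finrank_range_eq hιpιp hPp hQp (k := 1)
      (by omega) (by omega)
    obtain ⟨X1, hX1, hΘX1, hX1Θ, hX1c, hX1Up⟩ := UnitaryLeviSetup.exists_lift hbr hΘ hΘΘ hcp hιΘ hLp hιpapply T1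
      (by rw [hLptop]; exact Submodule.mem_top) hιT1 hT1ι
    rw [hT1r] at hX1Up
    obtain ⟨hs1, hi1, hi1', hj1, hj1'⟩ := hsplit X1 hΘX1 hX1Θ hX1c
    have hrk1 := hS X1 hX1 hΘX1 hX1Θ
    have hd1 := hdich X1 hX1 hΘX1 hX1Θ hX1c
    rw [hs1] at hrk1
    rw [hX1Up] at hrk1 hd1
    have hk_hkillm17 := hkillm17 X1 hX1 hΘX1 hX1Θ hX1c
    omega
  have hprof : ∀ X ∈ 𝔊, Θ * X = X → X * Θ = -X → X * ι = ι * X →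
      (Module.finrank ℂ (Up.map X) = 0 ∧ Module.finrank ℂ (Um.map X) = 0) ∨
        (Module.finrank ℂ (Up.map X) = 2 ∧ Module.finrank ℂ (Um.map X) = 16) ∨
        (Module.finrank ℂ (Up.map X) = 3 ∧ Module.finrank ℂ (Um.map X) = 15) ∨
        (Module.finrank ℂ (Up.map X) = 4 ∧ Module.finrank ℂ (Um.map X) = 14) ∨
        (Module.finrank ℂ (Up.map X) = 6 ∧ Module.finrank ℂ (Um.map X) = 12) ∨
        (Module.finrank ℂ (Up.map X) = 8 ∧ Module.finrank ℂ (Um.map X) = 10) ∨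
        (Module.finrank ℂ (Up.map X) = 9 ∧ Module.finrank ℂ (Um.map X) = 9) ∨
        (Module.finrank ℂ (Up.map X) = 10 ∧ Module.finrank ℂ (Um.map X) = 8) ∨
        (Module.finrank ℂ (Up.map X) = 12 ∧ Module.finrank ℂ (Um.map X) = 6) ∨
        (Module.finrank ℂ (Up.map X) = 14 ∧ Module.finrank ℂ (Um.map X) = 4) := by
    intro X hX hΘX hXΘ hXc
    obtain ⟨hs, hi, hi', hj, hj'⟩ := hsplit X hΘX hXΘ hXc
    have hkillm5' := hkillm5 X hX hΘX hXΘ hXc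
    have hkillm7' := hkillm7 X hX hΘX hXΘ hXc
    have hkillm11' := hkillm11 X hX hΘX hXΘ hXc
    have hkillm13' := hkillm13 X hX hΘX hXΘ hXc
    have hkillm17' := hkillm17 X hX hΘX hXΘ hXc
    have hrk := hS X hX hΘX hXΘ
    have hd := hdich X hX hΘX hXΘ hXc
    rw [hs] at hrk
    generalize Module.finrank ℂ ↥(Submodule.map X Um) = jj at *
    have hjle : jj ≤ 17 := by omega
    interval_cases jj
    · exact Or.inl ⟨by omega, rfl⟩
    · exfalso; omega
    · exfalso; omega
    · exfalso; omega
    · exact Or.inr (Or.inr (Or.inr (Or.inr (Or.inr (Or.inr (Or.inr (Or.inr (Or.inr (⟨by omega, rfl⟩)))))))))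
    · exact (hkillm5' rfl).elim
    · exact Or.inr (Or.inr (Or.inr (Or.inr (Or.inr (Or.inr (Or.inr (Or.inr (Or.inl ⟨by omega, rfl⟩))))))))
    · exact (hkillm7' rfl).elim
    · exact Or.inr (Or.inr (Or.inr (Or.inr (Or.inr (Or.inr (Or.inr (Or.inl ⟨by omega, rfl⟩)))))))
    · exact Or.inr (Or.inr (Or.inr (Or.inr (Or.inr (Or.inr (Or.inl ⟨by omega, rfl⟩))))))
    · exact Or.inr (Or.inr (Or.inr (Or.inr (Or.inr (Or.inl ⟨by omega, rfl⟩)))))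
    · exact (hkillm11' rfl).elim
    · exact Or.inr (Or.inr (Or.inr (Or.inr (Or.inl ⟨by omega, rfl⟩))))
    · exact (hkillm13' rfl).elim
    · exact Or.inr (Or.inr (Or.inr (Or.inl ⟨by omega, rfl⟩)))
    · exact Or.inr (Or.inr (Or.inl ⟨by omega, rfl⟩))
    · exact Or.inr (Or.inl ⟨by omega, rfl⟩)
    · exact (hkillm17' rfl).elim
  obtain ⟨⟨p, hp⟩, hp0⟩ := Module.finrank_pos_iff_exists_ne_zero.1 (show 0 < Module.finrank ℂ PU by omega)
  obtain ⟨⟨q, hq⟩, hq0⟩ := Module.finrank_pos_iff_exists_ne_zero.1 (show 0 < Module.finrank ℂ QU by omega)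
  obtain ⟨X₀, hX₀, hΘX₀, hX₀Θ, hX₀c, c₀, hιc₀, -, hX₀c0⟩ :=
    UnitaryLeviFull.exists_raise_commute_apply_ne_zero hbr hirr hΘ hΘΘ hQ hιmem hιι hιΘ hUm hUp
      ⟨p, fun h => hp0 (Subtype.ext h), ((hPU p).1 hp).1, ((hPU p).1 hp).2⟩
      ⟨q, fun h => hq0 (Subtype.ext h), ((hQU q).1 hq).1, ((hQU q).1 hq).2⟩
  have hX₀i : Module.finrank ℂ (Up.map X₀) ≠ 0 := fun h0 => by
    have hmem : X₀ c₀ ∈ Up.map X₀ := Submodule.mem_map_of_mem ((hUp c₀).2 hιc₀)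
    rw [Submodule.finrank_eq_zero.1 h0, Submodule.mem_bot] at hmem
    exact hX₀c0 hmem
  have hnotboth : ∀ X ∈ 𝔊, Θ * X = X → X * Θ = -X → X * ι = ι * X → ∀ X' ∈ 𝔊, Θ * X' = X' → X' * Θ = -X' →
      X' * ι = ι * X' → 18 < Module.finrank ℂ (Up.map X') + Module.finrank ℂ (Um.map X) → False := by
    intro X hX hΘX hXΘ hXc X' hX' hΘX' hX'Θ hX'c hgt
    obtain ⟨c, hc1, hc2⟩ := UnitaryGenericRank.exists_finrank_le_and_finrank_le (X'.restrict (hcp X' hX'c))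
      (X.restrict (hcp X hXc)) (X.restrict (hcm X hXc)) (X'.restrict (hcm X' hX'c))
    obtain ⟨hX₁, hΘX₁, hX₁Θ, hX₁c⟩ := UnitaryLeviSetup.add_smul_raise X hX hΘX hXΘ hXc X' hX' hΘX' hX'Θ hX'c c
    have hi₁ := UnitaryLeviSetup.finrank_map_add_smul hcp X X' hXc hX'c c hX₁c
    have hj₁ := UnitaryLeviSetup.finrank_map_add_smul hcm X X' hXc hX'c c hX₁c
    rw [UnitaryLeviRank.finrank_range_restrict] at hc1 hc2
    have hp := hprof (X + c • X') hX₁ hΘX₁ hX₁Θ hX₁c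
    rw [hi₁, hj₁] at hp
    omega
  have hzero : ∀ X ∈ 𝔊, Θ * X = X → X * Θ = -X → X * ι = ι * X → Module.finrank ℂ (Up.map X) = 0 → Module.finrank ℂ (Um.map X) = 0 → X = 0 := by
    intro X hX hΘX hXΘ hXc hi hj
    obtain ⟨hs, -, -, -, -⟩ := hsplit X hΘX hXΘ hXc
    rw [hi, hj, add_zero] at hs
    exact LinearMap.range_eq_bot.1 (Submodule.finrank_eq_zero.1 hs)
  have hjoint : ∀ v ∈ Q ⊓ LinearMap.ker B,
      (∀ X ∈ 𝔊, Θ * X = X → X * Θ = -X → X * ι = ι * X → X v = 0) → v = 0 := by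
    intro v hv hkill
    obtain ⟨hιv, -⟩ := (hQM v).1 hv
    have hvUm : v ∈ Um := (hUm v).2 hιv
    obtain ⟨⟨p₁, hp₁⟩, hp₁0⟩ := Module.finrank_pos_iff_exists_ne_zero.1 (show 0 < Module.finrank ℂ Pm by omega)
    have hq : ιm ⟨v, hvUm⟩ = -⟨v, hvUm⟩ := (hQm _).1 ((hQmmem _).2 hv)
    have h0 := UnitaryThetaCore.eq_zero_of_forall_raise_apply_eq_zero hbrLm hirrLm hιmmem hιmιm
      ⟨p₁, fun h => hp₁0 (Subtype.ext h), (hPm p₁).1 hp₁⟩ hq fun T hT hιT hTι => ?_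
    · exact congrArg Subtype.val h0
    obtain ⟨X, hX, hΘX, hXΘ, hXc, hXT⟩ := UnitaryLeviSetup.exists_lift_eq hbr hΘ hΘΘ hιΘ hLm hιmapply T hT hιT hTι
    exact Subtype.ext (by rw [← hXT]; exact hkill X hX hΘX hXΘ hXc)
  rcases hprof X₀ hX₀ hΘX₀ hX₀Θ hX₀c with ⟨h0i, h0j⟩ | ⟨h0i, h0j⟩ | ⟨h0i, h0j⟩ | ⟨h0i, h0j⟩ | ⟨h0i, h0j⟩ | ⟨h0i, h0j⟩ | ⟨h0i, h0j⟩ | ⟨h0i, h0j⟩ | ⟨h0i, h0j⟩ | ⟨h0i, h0j⟩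
  · exact hX₀i h0i
  · -- constant profile `(2, 16)`
    have hprofc : ∀ X ∈ 𝔊, Θ * X = X → X * Θ = -X → X * ι = ι * X → X ≠ 0 →
        Module.finrank ℂ (Up.map X) = 2 ∧ Module.finrank ℂ (Um.map X) = 16 := by
      intro X hX hΘX hXΘ hXc hX0
      rcases hprof X hX hΘX hXΘ hXc with ⟨hi, hj⟩ | ⟨hi, hj⟩ | ⟨hi, hj⟩ | ⟨hi, hj⟩ | ⟨hi, hj⟩ | ⟨hi, hj⟩ | ⟨hi, hj⟩ | ⟨hi, hj⟩ | ⟨hi, hj⟩ | ⟨hi, hj⟩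
      · exact (hX0 (hzero X hX hΘX hXΘ hXc hi hj)).elim
      · exact ⟨hi, hj⟩
      · exact (hnotboth X₀ hX₀ hΘX₀ hX₀Θ hX₀c X hX hΘX hXΘ hXc (by omega)).elim
      · exact (hnotboth X₀ hX₀ hΘX₀ hX₀Θ hX₀c X hX hΘX hXΘ hXc (by omega)).elim
      · exact (hnotboth X₀ hX₀ hΘX₀ hX₀Θ hX₀c X hX hΘX hXΘ hXc (by omega)).elim
      · exact (hnotboth X₀ hX₀ hΘX₀ hX₀Θ hX₀c X hX hΘX hXΘ hXc (by omega)).elim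
      · exact (hnotboth X₀ hX₀ hΘX₀ hX₀Θ hX₀c X hX hΘX hXΘ hXc (by omega)).elim
      · exact (hnotboth X₀ hX₀ hΘX₀ hX₀Θ hX₀c X hX hΘX hXΘ hXc (by omega)).elim
      · exact (hnotboth X₀ hX₀ hΘX₀ hX₀Θ hX₀c X hX hΘX hXΘ hXc (by omega)).elim
      · exact (hnotboth X₀ hX₀ hΘX₀ hX₀Θ hX₀c X hX hΘX hXΘ hXc (by omega)).elim
    obtain ⟨A, hA, hιpA, hAιp, hAne, hA2⟩ :=
      UnitaryConstantRank.exists_raise_rank_ne_two hbrLp hirrLp hιpmem hιpιp hPp hQp (by omega) (by omega) (by omega)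
        (s := fun v w : Up => s (v : W) w) (hsU Up) (fun v w => hsymm v w) hPpQp hdefPp hdefQp hadjLp
    obtain ⟨XA, hXA, hΘXA, hXAΘ, hXAc, hXAUp⟩ := UnitaryLeviSetup.exists_lift hbr hΘ hΘΘ hcp hιΘ hLp hιpapply A hA hιpA hAιp
    have hA0 : Module.finrank ℂ (LinearMap.range A) ≠ 0 := fun h =>
      hAne (LinearMap.range_eq_bot.1 (Submodule.finrank_eq_zero.1 h))
    have hXA0 : XA ≠ 0 := fun h0 => hA0 (by rw [← hXAUp, h0, Submodule.map_zero, finrank_bot])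
    have hpA := hprofc XA hXA hΘXA hXAΘ hXAc hXA0
    rw [← hXAUp] at hA2
    omega
  · -- constant profile `(3, 15)`
    have hprofc : ∀ X ∈ 𝔊, Θ * X = X → X * Θ = -X → X * ι = ι * X → X ≠ 0 →
        Module.finrank ℂ (Up.map X) = 3 ∧ Module.finrank ℂ (Um.map X) = 15 := by
      intro X hX hΘX hXΘ hXc hX0
      rcases hprof X hX hΘX hXΘ hXc with ⟨hi, hj⟩ | ⟨hi, hj⟩ | ⟨hi, hj⟩ | ⟨hi, hj⟩ | ⟨hi, hj⟩ | ⟨hi, hj⟩ | ⟨hi, hj⟩ | ⟨hi, hj⟩ | ⟨hi, hj⟩ | ⟨hi, hj⟩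
      · exact (hX0 (hzero X hX hΘX hXΘ hXc hi hj)).elim
      · exact (hnotboth X hX hΘX hXΘ hXc X₀ hX₀ hΘX₀ hX₀Θ hX₀c (by omega)).elim
      · exact ⟨hi, hj⟩
      · exact (hnotboth X₀ hX₀ hΘX₀ hX₀Θ hX₀c X hX hΘX hXΘ hXc (by omega)).elim
      · exact (hnotboth X₀ hX₀ hΘX₀ hX₀Θ hX₀c X hX hΘX hXΘ hXc (by omega)).elim
      · exact (hnotboth X₀ hX₀ hΘX₀ hX₀Θ hX₀c X hX hΘX hXΘ hXc (by omega)).elim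
      · exact (hnotboth X₀ hX₀ hΘX₀ hX₀Θ hX₀c X hX hΘX hXΘ hXc (by omega)).elim
      · exact (hnotboth X₀ hX₀ hΘX₀ hX₀Θ hX₀c X hX hΘX hXΘ hXc (by omega)).elim
      · exact (hnotboth X₀ hX₀ hΘX₀ hX₀Θ hX₀c X hX hΘX hXΘ hXc (by omega)).elim
      · exact (hnotboth X₀ hX₀ hΘX₀ hX₀Θ hX₀c X hX hΘX hXΘ hXc (by omega)).elim
    obtain ⟨hymem, hιpy, hyιp, hyrk⟩ := UnitaryLeviSetup.restrict_mem hcp hLp hιpapply X₀ hX₀ hΘX₀ hX₀Θ hX₀c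
    have hSp : ∀ A ∈ Lp, ιp * A = A → A * ιp = -A →
        Module.finrank ℂ (LinearMap.range A) = 0 ∨ Module.finrank ℂ (LinearMap.range A) = 3 := by
      intro A hA hιA hAι
      by_cases hA0 : A = 0
      · left; rw [hA0, LinearMap.range_zero, finrank_bot]
      · obtain ⟨XA, hXA, hΘXA, hXAΘ, hXAc, hXAUp⟩ :=
          UnitaryLeviSetup.exists_lift hbr hΘ hΘΘ hcp hιΘ hLp hιpapply A hA hιA hAι
        have hXA0 : XA ≠ 0 := fun h0 => hA0 (LinearMap.range_eq_bot.1 (Submodule.finrank_eq_zero.1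
          (by rw [← hXAUp, h0, Submodule.map_zero, finrank_bot])))
        right; rw [← hXAUp]; exact (hprofc XA hXA hΘXA hXAΘ hXAc hXA0).1
    exact UnitaryThirtyTwoThirtyFive.subFourteenEighteen_rank3 hbrLp hirrLp hιpmem hιpιp hPp hQp (by omega) (by omega)
      (s := fun v w : Up => s (v : W) w) (hsU Up) (hsmU Up) (fun v w => hsymm v w) hPpQp hdefPp hdefQp hadjLp hSp
      hymem hιpy hyιp (by rw [hyrk, h0i])
  · -- constant profile `(4, 14)`
    have hprofc : ∀ X ∈ 𝔊, Θ * X = X → X * Θ = -X → X * ι = ι * X → X ≠ 0 →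
        Module.finrank ℂ (Up.map X) = 4 ∧ Module.finrank ℂ (Um.map X) = 14 := by
      intro X hX hΘX hXΘ hXc hX0
      rcases hprof X hX hΘX hXΘ hXc with ⟨hi, hj⟩ | ⟨hi, hj⟩ | ⟨hi, hj⟩ | ⟨hi, hj⟩ | ⟨hi, hj⟩ | ⟨hi, hj⟩ | ⟨hi, hj⟩ | ⟨hi, hj⟩ | ⟨hi, hj⟩ | ⟨hi, hj⟩
      · exact (hX0 (hzero X hX hΘX hXΘ hXc hi hj)).elim
      · exact (hnotboth X hX hΘX hXΘ hXc X₀ hX₀ hΘX₀ hX₀Θ hX₀c (by omega)).elim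
      · exact (hnotboth X hX hΘX hXΘ hXc X₀ hX₀ hΘX₀ hX₀Θ hX₀c (by omega)).elim
      · exact ⟨hi, hj⟩
      · exact (hnotboth X₀ hX₀ hΘX₀ hX₀Θ hX₀c X hX hΘX hXΘ hXc (by omega)).elim
      · exact (hnotboth X₀ hX₀ hΘX₀ hX₀Θ hX₀c X hX hΘX hXΘ hXc (by omega)).elim
      · exact (hnotboth X₀ hX₀ hΘX₀ hX₀Θ hX₀c X hX hΘX hXΘ hXc (by omega)).elim
      · exact (hnotboth X₀ hX₀ hΘX₀ hX₀Θ hX₀c X hX hΘX hXΘ hXc (by omega)).elim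
      · exact (hnotboth X₀ hX₀ hΘX₀ hX₀Θ hX₀c X hX hΘX hXΘ hXc (by omega)).elim
      · exact (hnotboth X₀ hX₀ hΘX₀ hX₀Θ hX₀c X hX hΘX hXΘ hXc (by omega)).elim
    obtain ⟨hymem, hιpy, hyιp, hyrk⟩ := UnitaryLeviSetup.restrict_mem hcp hLp hιpapply X₀ hX₀ hΘX₀ hX₀Θ hX₀c
    have hSp : ∀ A ∈ Lp, ιp * A = A → A * ιp = -A →
        Module.finrank ℂ (LinearMap.range A) = 0 ∨ Module.finrank ℂ (LinearMap.range A) = 4 := by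
      intro A hA hιA hAι
      by_cases hA0 : A = 0
      · left; rw [hA0, LinearMap.range_zero, finrank_bot]
      · obtain ⟨XA, hXA, hΘXA, hXAΘ, hXAc, hXAUp⟩ :=
          UnitaryLeviSetup.exists_lift hbr hΘ hΘΘ hcp hιΘ hLp hιpapply A hA hιA hAι
        have hXA0 : XA ≠ 0 := fun h0 => hA0 (LinearMap.range_eq_bot.1 (Submodule.finrank_eq_zero.1
          (by rw [← hXAUp, h0, Submodule.map_zero, finrank_bot])))
        right; rw [← hXAUp]; exact (hprofc XA hXA hΘXA hXAΘ hXAc hXA0).1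
    exact UnitaryThirtyTwoThirtyFive.subFourteenEighteen_rank4 hbrLp hirrLp hιpmem hιpιp hPp hQp (by omega) (by omega)
      (s := fun v w : Up => s (v : W) w) (hsU Up) (hsmU Up) (fun v w => hsymm v w) hPpQp hdefPp hdefQp hadjLp hSp
      hymem hιpy hyιp (by rw [hyrk, h0i])
  · -- constant profile `(6, 12)`
    have hprofc : ∀ X ∈ 𝔊, Θ * X = X → X * Θ = -X → X * ι = ι * X → X ≠ 0 →
        Module.finrank ℂ (Up.map X) = 6 ∧ Module.finrank ℂ (Um.map X) = 12 := by
      intro X hX hΘX hXΘ hXc hX0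
      rcases hprof X hX hΘX hXΘ hXc with ⟨hi, hj⟩ | ⟨hi, hj⟩ | ⟨hi, hj⟩ | ⟨hi, hj⟩ | ⟨hi, hj⟩ | ⟨hi, hj⟩ | ⟨hi, hj⟩ | ⟨hi, hj⟩ | ⟨hi, hj⟩ | ⟨hi, hj⟩
      · exact (hX0 (hzero X hX hΘX hXΘ hXc hi hj)).elim
      · exact (hnotboth X hX hΘX hXΘ hXc X₀ hX₀ hΘX₀ hX₀Θ hX₀c (by omega)).elim
      · exact (hnotboth X hX hΘX hXΘ hXc X₀ hX₀ hΘX₀ hX₀Θ hX₀c (by omega)).elim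
      · exact (hnotboth X hX hΘX hXΘ hXc X₀ hX₀ hΘX₀ hX₀Θ hX₀c (by omega)).elim
      · exact ⟨hi, hj⟩
      · exact (hnotboth X₀ hX₀ hΘX₀ hX₀Θ hX₀c X hX hΘX hXΘ hXc (by omega)).elim
      · exact (hnotboth X₀ hX₀ hΘX₀ hX₀Θ hX₀c X hX hΘX hXΘ hXc (by omega)).elim
      · exact (hnotboth X₀ hX₀ hΘX₀ hX₀Θ hX₀c X hX hΘX hXΘ hXc (by omega)).elim
      · exact (hnotboth X₀ hX₀ hΘX₀ hX₀Θ hX₀c X hX hΘX hXΘ hXc (by omega)).elim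
      · exact (hnotboth X₀ hX₀ hΘX₀ hX₀Θ hX₀c X hX hΘX hXΘ hXc (by omega)).elim
    obtain ⟨hymem, hιpy, hyιp, hyrk⟩ := UnitaryLeviSetup.restrict_mem hcp hLp hιpapply X₀ hX₀ hΘX₀ hX₀Θ hX₀c
    have hSp : ∀ A ∈ Lp, ιp * A = A → A * ιp = -A →
        Module.finrank ℂ (LinearMap.range A) = 0 ∨ Module.finrank ℂ (LinearMap.range A) = 6 := by
      intro A hA hιA hAι
      by_cases hA0 : A = 0
      · left; rw [hA0, LinearMap.range_zero, finrank_bot]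
      · obtain ⟨XA, hXA, hΘXA, hXAΘ, hXAc, hXAUp⟩ :=
          UnitaryLeviSetup.exists_lift hbr hΘ hΘΘ hcp hιΘ hLp hιpapply A hA hιA hAι
        have hXA0 : XA ≠ 0 := fun h0 => hA0 (LinearMap.range_eq_bot.1 (Submodule.finrank_eq_zero.1
          (by rw [← hXAUp, h0, Submodule.map_zero, finrank_bot])))
        right; rw [← hXAUp]; exact (hprofc XA hXA hΘXA hXAΘ hXAc hXA0).1
    exact UnitaryThirtyTwoThirtyFive.subFourteenEighteen_rank6 hbrLp hirrLp hιpmem hιpιp hPp hQp (by omega) (by omega)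
      (s := fun v w : Up => s (v : W) w) (hsU Up) (hsmU Up) (fun v w => hsymm v w) hPpQp hdefPp hdefQp hadjLp hSp
      hymem hιpy hyιp (by rw [hyrk, h0i])
  · -- constant profile `(8, 10)`
    have hprofc : ∀ X ∈ 𝔊, Θ * X = X → X * Θ = -X → X * ι = ι * X → X ≠ 0 →
        Module.finrank ℂ (Up.map X) = 8 ∧ Module.finrank ℂ (Um.map X) = 10 := by
      intro X hX hΘX hXΘ hXc hX0
      rcases hprof X hX hΘX hXΘ hXc with ⟨hi, hj⟩ | ⟨hi, hj⟩ | ⟨hi, hj⟩ | ⟨hi, hj⟩ | ⟨hi, hj⟩ | ⟨hi, hj⟩ | ⟨hi, hj⟩ | ⟨hi, hj⟩ | ⟨hi, hj⟩ | ⟨hi, hj⟩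
      · exact (hX0 (hzero X hX hΘX hXΘ hXc hi hj)).elim
      · exact (hnotboth X hX hΘX hXΘ hXc X₀ hX₀ hΘX₀ hX₀Θ hX₀c (by omega)).elim
      · exact (hnotboth X hX hΘX hXΘ hXc X₀ hX₀ hΘX₀ hX₀Θ hX₀c (by omega)).elim
      · exact (hnotboth X hX hΘX hXΘ hXc X₀ hX₀ hΘX₀ hX₀Θ hX₀c (by omega)).elim
      · exact (hnotboth X hX hΘX hXΘ hXc X₀ hX₀ hΘX₀ hX₀Θ hX₀c (by omega)).elim
      · exact ⟨hi, hj⟩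
      · exact (hnotboth X₀ hX₀ hΘX₀ hX₀Θ hX₀c X hX hΘX hXΘ hXc (by omega)).elim
      · exact (hnotboth X₀ hX₀ hΘX₀ hX₀Θ hX₀c X hX hΘX hXΘ hXc (by omega)).elim
      · exact (hnotboth X₀ hX₀ hΘX₀ hX₀Θ hX₀c X hX hΘX hXΘ hXc (by omega)).elim
      · exact (hnotboth X₀ hX₀ hΘX₀ hX₀Θ hX₀c X hX hΘX hXΘ hXc (by omega)).elim
    obtain ⟨hymem, hιpy, hyιp, hyrk⟩ := UnitaryLeviSetup.restrict_mem hcp hLp hιpapply X₀ hX₀ hΘX₀ hX₀Θ hX₀c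
    have hSp : ∀ A ∈ Lp, ιp * A = A → A * ιp = -A →
        Module.finrank ℂ (LinearMap.range A) = 0 ∨ Module.finrank ℂ (LinearMap.range A) = 8 := by
      intro A hA hιA hAι
      by_cases hA0 : A = 0
      · left; rw [hA0, LinearMap.range_zero, finrank_bot]
      · obtain ⟨XA, hXA, hΘXA, hXAΘ, hXAc, hXAUp⟩ :=
          UnitaryLeviSetup.exists_lift hbr hΘ hΘΘ hcp hιΘ hLp hιpapply A hA hιA hAι
        have hXA0 : XA ≠ 0 := fun h0 => hA0 (LinearMap.range_eq_bot.1 (Submodule.finrank_eq_zero.1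
          (by rw [← hXAUp, h0, Submodule.map_zero, finrank_bot])))
        right; rw [← hXAUp]; exact (hprofc XA hXA hΘXA hXAΘ hXAc hXA0).1
    exact UnitaryThirtyTwoThirtyFive.subFourteenEighteen_rank8 hbrLp hirrLp hιpmem hιpιp hPp hQp (by omega) (by omega)
      (s := fun v w : Up => s (v : W) w) (hsU Up) (hsmU Up) (fun v w => hsymm v w) hPpQp hdefPp hdefQp hadjLp hSp
      hymem hιpy hyιp (by rw [hyrk, h0i])
  · -- constant profile `(9, 9)`
    have hprofc : ∀ X ∈ 𝔊, Θ * X = X → X * Θ = -X → X * ι = ι * X → X ≠ 0 →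
        Module.finrank ℂ (Up.map X) = 9 ∧ Module.finrank ℂ (Um.map X) = 9 := by
      intro X hX hΘX hXΘ hXc hX0
      rcases hprof X hX hΘX hXΘ hXc with ⟨hi, hj⟩ | ⟨hi, hj⟩ | ⟨hi, hj⟩ | ⟨hi, hj⟩ | ⟨hi, hj⟩ | ⟨hi, hj⟩ | ⟨hi, hj⟩ | ⟨hi, hj⟩ | ⟨hi, hj⟩ | ⟨hi, hj⟩
      · exact (hX0 (hzero X hX hΘX hXΘ hXc hi hj)).elim
      · exact (hnotboth X hX hΘX hXΘ hXc X₀ hX₀ hΘX₀ hX₀Θ hX₀c (by omega)).elim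
      · exact (hnotboth X hX hΘX hXΘ hXc X₀ hX₀ hΘX₀ hX₀Θ hX₀c (by omega)).elim
      · exact (hnotboth X hX hΘX hXΘ hXc X₀ hX₀ hΘX₀ hX₀Θ hX₀c (by omega)).elim
      · exact (hnotboth X hX hΘX hXΘ hXc X₀ hX₀ hΘX₀ hX₀Θ hX₀c (by omega)).elim
      · exact (hnotboth X hX hΘX hXΘ hXc X₀ hX₀ hΘX₀ hX₀Θ hX₀c (by omega)).elim
      · exact ⟨hi, hj⟩
      · exact (hnotboth X₀ hX₀ hΘX₀ hX₀Θ hX₀c X hX hΘX hXΘ hXc (by omega)).elim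
      · exact (hnotboth X₀ hX₀ hΘX₀ hX₀Θ hX₀c X hX hΘX hXΘ hXc (by omega)).elim
      · exact (hnotboth X₀ hX₀ hΘX₀ hX₀Θ hX₀c X hX hΘX hXΘ hXc (by omega)).elim
    obtain ⟨hymem, hιpy, hyιp, hyrk⟩ := UnitaryLeviSetup.restrict_mem hcp hLp hιpapply X₀ hX₀ hΘX₀ hX₀Θ hX₀c
    have hSp : ∀ A ∈ Lp, ιp * A = A → A * ιp = -A →
        Module.finrank ℂ (LinearMap.range A) = 0 ∨ Module.finrank ℂ (LinearMap.range A) = 9 := by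
      intro A hA hιA hAι
      by_cases hA0 : A = 0
      · left; rw [hA0, LinearMap.range_zero, finrank_bot]
      · obtain ⟨XA, hXA, hΘXA, hXAΘ, hXAc, hXAUp⟩ :=
          UnitaryLeviSetup.exists_lift hbr hΘ hΘΘ hcp hιΘ hLp hιpapply A hA hιA hAι
        have hXA0 : XA ≠ 0 := fun h0 => hA0 (LinearMap.range_eq_bot.1 (Submodule.finrank_eq_zero.1
          (by rw [← hXAUp, h0, Submodule.map_zero, finrank_bot])))
        right; rw [← hXAUp]; exact (hprofc XA hXA hΘXA hXAΘ hXAc hXA0).1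
    exact UnitaryThirtyTwoThirtyFive.subFourteenEighteen_rank9 hbrLp hirrLp hιpmem hιpιp hPp hQp (by omega) (by omega)
      (s := fun v w : Up => s (v : W) w) (hsU Up) (hsmU Up) (fun v w => hsymm v w) hPpQp hdefPp hdefQp hadjLp hSp
      hymem hιpy hyιp (by rw [hyrk, h0i])
  · -- constant profile `(10, 8)`
    have hprofc : ∀ X ∈ 𝔊, Θ * X = X → X * Θ = -X → X * ι = ι * X → X ≠ 0 →
        Module.finrank ℂ (Up.map X) = 10 ∧ Module.finrank ℂ (Um.map X) = 8 := by
      intro X hX hΘX hXΘ hXc hX0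
      rcases hprof X hX hΘX hXΘ hXc with ⟨hi, hj⟩ | ⟨hi, hj⟩ | ⟨hi, hj⟩ | ⟨hi, hj⟩ | ⟨hi, hj⟩ | ⟨hi, hj⟩ | ⟨hi, hj⟩ | ⟨hi, hj⟩ | ⟨hi, hj⟩ | ⟨hi, hj⟩
      · exact (hX0 (hzero X hX hΘX hXΘ hXc hi hj)).elim
      · exact (hnotboth X hX hΘX hXΘ hXc X₀ hX₀ hΘX₀ hX₀Θ hX₀c (by omega)).elim
      · exact (hnotboth X hX hΘX hXΘ hXc X₀ hX₀ hΘX₀ hX₀Θ hX₀c (by omega)).elim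
      · exact (hnotboth X hX hΘX hXΘ hXc X₀ hX₀ hΘX₀ hX₀Θ hX₀c (by omega)).elim
      · exact (hnotboth X hX hΘX hXΘ hXc X₀ hX₀ hΘX₀ hX₀Θ hX₀c (by omega)).elim
      · exact (hnotboth X hX hΘX hXΘ hXc X₀ hX₀ hΘX₀ hX₀Θ hX₀c (by omega)).elim
      · exact (hnotboth X hX hΘX hXΘ hXc X₀ hX₀ hΘX₀ hX₀Θ hX₀c (by omega)).elim
      · exact ⟨hi, hj⟩
      · exact (hnotboth X₀ hX₀ hΘX₀ hX₀Θ hX₀c X hX hΘX hXΘ hXc (by omega)).elim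
      · exact (hnotboth X₀ hX₀ hΘX₀ hX₀Θ hX₀c X hX hΘX hXΘ hXc (by omega)).elim
    have hnum0 : Module.finrank ℂ QU ≤ (fun t : ℕ => (max (max (18 - 10 * t) (14 - 6 * t)) (6 - 2 * t))) 0 := by beta_reduce; omega
    have hnum1 : (fun t : ℕ => (min (min (8 * t) (2 * t + 6)) 10)) 0 = 0 := by beta_reduce; omega
    have hnum2 : ∀ t : ℕ, (fun t : ℕ => (max (max (18 - 10 * t) (14 - 6 * t)) (6 - 2 * t))) t ≤ (fun t : ℕ => (max (max (18 - 10 * t) (14 - 6 * t)) (6 - 2 * t))) (t + 1) + (Module.finrank ℂ PU - (t + 1) * 4) := by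
      intro t; beta_reduce; omega
    have hnum3 : ∀ t : ℕ, (fun t : ℕ => (min (min (8 * t) (2 * t + 6)) 10)) t + (fun t : ℕ => (max (max (18 - 10 * t) (14 - 6 * t)) (6 - 2 * t))) (t + 1) ≤ (fun t : ℕ => (min (min (8 * t) (2 * t + 6)) 10)) (t + 1) := by
      intro t; beta_reduce; omega
    have hnum4 : ∀ t : ℕ, (fun t : ℕ => (min (min (8 * t) (2 * t + 6)) 10)) t < Module.finrank ℂ ↥(Q ⊓ LinearMap.ker B) := by
      intro t; beta_reduce; omega
    exact UnitaryOrthogonalChain.false_of_constProfile_pos hbr hΘΘ hP hQ hadd hsmul hsymm hPQ hdefP hdefQ hadj hB hΘB hBΘ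
      hmin' hιι hιΘ hιs hUm hUp hPM hQM hPU hQU hfinQU' (i := 10) (j := 8) (c := 4) hprofc (by omega) (by omega)
      (by omega) (fun t : ℕ => (max (max (18 - 10 * t) (14 - 6 * t)) (6 - 2 * t))) (fun t : ℕ => (min (min (8 * t) (2 * t + 6)) 10)) hnum0 hnum1 hnum2 hnum3 hnum4 hjoint
  · -- constant profile `(12, 6)`
    have hprofc : ∀ X ∈ 𝔊, Θ * X = X → X * Θ = -X → X * ι = ι * X → X ≠ 0 →
        Module.finrank ℂ (Up.map X) = 12 ∧ Module.finrank ℂ (Um.map X) = 6 := by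
      intro X hX hΘX hXΘ hXc hX0
      rcases hprof X hX hΘX hXΘ hXc with ⟨hi, hj⟩ | ⟨hi, hj⟩ | ⟨hi, hj⟩ | ⟨hi, hj⟩ | ⟨hi, hj⟩ | ⟨hi, hj⟩ | ⟨hi, hj⟩ | ⟨hi, hj⟩ | ⟨hi, hj⟩ | ⟨hi, hj⟩
      · exact (hX0 (hzero X hX hΘX hXΘ hXc hi hj)).elim
      · exact (hnotboth X hX hΘX hXΘ hXc X₀ hX₀ hΘX₀ hX₀Θ hX₀c (by omega)).elim
      · exact (hnotboth X hX hΘX hXΘ hXc X₀ hX₀ hΘX₀ hX₀Θ hX₀c (by omega)).elim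
      · exact (hnotboth X hX hΘX hXΘ hXc X₀ hX₀ hΘX₀ hX₀Θ hX₀c (by omega)).elim
      · exact (hnotboth X hX hΘX hXΘ hXc X₀ hX₀ hΘX₀ hX₀Θ hX₀c (by omega)).elim
      · exact (hnotboth X hX hΘX hXΘ hXc X₀ hX₀ hΘX₀ hX₀Θ hX₀c (by omega)).elim
      · exact (hnotboth X hX hΘX hXΘ hXc X₀ hX₀ hΘX₀ hX₀Θ hX₀c (by omega)).elim
      · exact (hnotboth X hX hΘX hXΘ hXc X₀ hX₀ hΘX₀ hX₀Θ hX₀c (by omega)).elim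
      · exact ⟨hi, hj⟩
      · exact (hnotboth X₀ hX₀ hΘX₀ hX₀Θ hX₀c X hX hΘX hXΘ hXc (by omega)).elim
    have hnum0 : Module.finrank ℂ QU ≤ (fun t : ℕ => (max (18 - 12 * t) (12 - 6 * t))) 0 := by beta_reduce; omega
    have hnum1 : (fun t : ℕ => (min (6 * t) 6)) 0 = 0 := by beta_reduce; omega
    have hnum2 : ∀ t : ℕ, (fun t : ℕ => (max (18 - 12 * t) (12 - 6 * t))) t ≤ (fun t : ℕ => (max (18 - 12 * t) (12 - 6 * t))) (t + 1) + (Module.finrank ℂ PU - (t + 1) * 2) := by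
      intro t; beta_reduce; omega
    have hnum3 : ∀ t : ℕ, (fun t : ℕ => (min (6 * t) 6)) t + (fun t : ℕ => (max (18 - 12 * t) (12 - 6 * t))) (t + 1) ≤ (fun t : ℕ => (min (6 * t) 6)) (t + 1) := by
      intro t; beta_reduce; omega
    have hnum4 : ∀ t : ℕ, (fun t : ℕ => (min (6 * t) 6)) t < Module.finrank ℂ ↥(Q ⊓ LinearMap.ker B) := by
      intro t; beta_reduce; omega
    exact UnitaryOrthogonalChain.false_of_constProfile_pos hbr hΘΘ hP hQ hadd hsmul hsymm hPQ hdefP hdefQ hadj hB hΘB hBΘ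
      hmin' hιι hιΘ hιs hUm hUp hPM hQM hPU hQU hfinQU' (i := 12) (j := 6) (c := 2) hprofc (by omega) (by omega)
      (by omega) (fun t : ℕ => (max (18 - 12 * t) (12 - 6 * t))) (fun t : ℕ => (min (6 * t) 6)) hnum0 hnum1 hnum2 hnum3 hnum4 hjoint
  · -- constant profile `(14, 4)`
    have hprofc : ∀ X ∈ 𝔊, Θ * X = X → X * Θ = -X → X * ι = ι * X → X ≠ 0 →
        Module.finrank ℂ (Up.map X) = 14 ∧ Module.finrank ℂ (Um.map X) = 4 := by
      intro X hX hΘX hXΘ hXc hX0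
      rcases hprof X hX hΘX hXΘ hXc with ⟨hi, hj⟩ | ⟨hi, hj⟩ | ⟨hi, hj⟩ | ⟨hi, hj⟩ | ⟨hi, hj⟩ | ⟨hi, hj⟩ | ⟨hi, hj⟩ | ⟨hi, hj⟩ | ⟨hi, hj⟩ | ⟨hi, hj⟩
      · exact (hX0 (hzero X hX hΘX hXΘ hXc hi hj)).elim
      · exact (hnotboth X hX hΘX hXΘ hXc X₀ hX₀ hΘX₀ hX₀Θ hX₀c (by omega)).elim
      · exact (hnotboth X hX hΘX hXΘ hXc X₀ hX₀ hΘX₀ hX₀Θ hX₀c (by omega)).elim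
      · exact (hnotboth X hX hΘX hXΘ hXc X₀ hX₀ hΘX₀ hX₀Θ hX₀c (by omega)).elim
      · exact (hnotboth X hX hΘX hXΘ hXc X₀ hX₀ hΘX₀ hX₀Θ hX₀c (by omega)).elim
      · exact (hnotboth X hX hΘX hXΘ hXc X₀ hX₀ hΘX₀ hX₀Θ hX₀c (by omega)).elim
      · exact (hnotboth X hX hΘX hXΘ hXc X₀ hX₀ hΘX₀ hX₀Θ hX₀c (by omega)).elim
      · exact (hnotboth X hX hΘX hXΘ hXc X₀ hX₀ hΘX₀ hX₀Θ hX₀c (by omega)).elim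
      · exact (hnotboth X hX hΘX hXΘ hXc X₀ hX₀ hΘX₀ hX₀Θ hX₀c (by omega)).elim
      · exact ⟨hi, hj⟩
    have hnum0 : Module.finrank ℂ QU ≤ (fun t : ℕ => (max (18 - 14 * t) (8 - 4 * t))) 0 := by beta_reduce; omega
    have hnum1 : (fun t : ℕ => (min (4 * t) 4)) 0 = 0 := by beta_reduce; omega
    have hnum2 : ∀ t : ℕ, (fun t : ℕ => (max (18 - 14 * t) (8 - 4 * t))) t ≤ (fun t : ℕ => (max (18 - 14 * t) (8 - 4 * t))) (t + 1) + (Module.finrank ℂ PU - (t + 1) * 0) := by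
      intro t; beta_reduce; omega
    have hnum3 : ∀ t : ℕ, (fun t : ℕ => (min (4 * t) 4)) t + (fun t : ℕ => (max (18 - 14 * t) (8 - 4 * t))) (t + 1) ≤ (fun t : ℕ => (min (4 * t) 4)) (t + 1) := by
      intro t; beta_reduce; omega
    have hnum4 : ∀ t : ℕ, (fun t : ℕ => (min (4 * t) 4)) t < Module.finrank ℂ ↥(Q ⊓ LinearMap.ker B) := by
      intro t; beta_reduce; omega
    exact UnitaryOrthogonalChain.false_of_constProfile_pos hbr hΘΘ hP hQ hadd hsmul hsymm hPQ hdefP hdefQ hadj hB hΘB hBΘ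
      hmin' hιι hιΘ hιs hUm hUp hPM hQM hPU hQU hfinQU' (i := 14) (j := 4) (c := 0) hprofc (by omega) (by omega)
      (by omega) (fun t : ℕ => (max (18 - 14 * t) (8 - 4 * t))) (fun t : ℕ => (min (4 * t) 4)) hnum0 hnum1 hnum2 hnum3 hnum4 hjoint

/-- `(32 | 35)`, minimal rank `19`: `L⁺` of type `(13 | 19)` is full and a lift with `i = 1` has no feasible `j`. [cite: Ribet1983, Thm. 3] [cite: Gordon1997, Thm. 6.3 (3)]
[cite: Deligne1982HodgeCycles, I §3 Prop. 3.4, 3.6] [cite: GoodmanWallachGTM255, §4.1.1] -/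
theorem UnitaryThirtyTwoThirtyFive.no_minRank_19 [FiniteDimensional ℂ W] {𝔊 : Submodule ℂ (Module.End ℂ W)}
    (hbr : ∀ Y ∈ 𝔊, ∀ Z ∈ 𝔊, Y * Z - Z * Y ∈ 𝔊)
    (hirr : ∀ U : Submodule ℂ W, (∀ A ∈ 𝔊, ∀ u ∈ U, A u ∈ U) → U = ⊥ ∨ U = ⊤)
    {Θ : Module.End ℂ W} (hΘ : Θ ∈ 𝔊) (hΘΘ : Θ * Θ = 1)
    {P Q : Submodule ℂ W} (hP : ∀ x, x ∈ P ↔ Θ x = x) (hQ : ∀ x, x ∈ Q ↔ Θ x = -x)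
    (hP32 : Module.finrank ℂ P = 32) (hQ35 : Module.finrank ℂ Q = 35)
    {s : W → W → ℂ} (hadd : ∀ x y z, s (x + y) z = s x z + s y z)
    (hsmul : ∀ (c : ℂ) (x y : W), s (c • x) y = c * s x y) (hsymm : ∀ x y, s y x = starRingEnd ℂ (s x y))
    (hPQ : ∀ p ∈ P, ∀ q ∈ Q, s p q = 0) (hdefP : ∀ p ∈ P, s p p = 0 → p = 0) (hdefQ : ∀ q ∈ Q, s q q = 0 → q = 0)
    (hadj : ∀ X ∈ 𝔊, ∃ Y ∈ 𝔊, ∀ x y, s (X x) y = s x (Y y))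
    (hS : ∀ B' ∈ 𝔊, Θ * B' = B' → B' * Θ = -B' →
      Module.finrank ℂ (LinearMap.range B') = 0 ∨ Module.finrank ℂ (LinearMap.range B') = 19 ∨ Module.finrank ℂ (LinearMap.range B') = 20 ∨ Module.finrank ℂ (LinearMap.range B') = 21 ∨ Module.finrank ℂ (LinearMap.range B') = 23 ∨ Module.finrank ℂ (LinearMap.range B') = 25 ∨ Module.finrank ℂ (LinearMap.range B') = 26 ∨ Module.finrank ℂ (LinearMap.range B') = 27 ∨ Module.finrank ℂ (LinearMap.range B') = 28 ∨ Module.finrank ℂ (LinearMap.range B') = 30)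
    {B : Module.End ℂ W} (hB : B ∈ 𝔊) (hΘB : Θ * B = B) (hBΘ : B * Θ = -B)
    (hr : Module.finrank ℂ (LinearMap.range B) = 19) : False := by
  classical
  have hsU : ∀ U : Submodule ℂ W, ∀ x y z : U, s ((x + y : U) : W) z = s (x : W) z + s (y : W) z :=
    fun U x y z => by simp only [Submodule.coe_add, hadd]
  have hsmU : ∀ U : Submodule ℂ W, ∀ (c : ℂ) (x y : U), s ((c • x : U) : W) y = c * s (x : W) y :=
    fun U c x y => by simp only [Submodule.coe_smul, hsmul]
  have hno1 : ∀ B' ∈ 𝔊, Θ * B' = B' → B' * Θ = -B' → Module.finrank ℂ (LinearMap.range B') ≠ 1 := by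
    intro B' hB' hΘB' hB'Θ h1
    rcases hS B' hB' hΘB' hB'Θ with h | h | h | h | h | h | h | h | h | h <;> omega
  have hmin : ∀ Y ∈ 𝔊, Θ * Y = Y → Y * Θ = -Y → Y ≠ 0 → 19 ≤ Module.finrank ℂ (LinearMap.range Y) := by
    intro Y hY hΘY hYΘ hY0
    have h0 : Module.finrank ℂ (LinearMap.range Y) ≠ 0 := fun h =>
      hY0 (LinearMap.range_eq_bot.1 (Submodule.finrank_eq_zero.1 h))
    rcases hS Y hY hΘY hYΘ with h | h | h | h | h | h | h | h | h | h <;> omega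
  have hmin' : ∀ Z ∈ 𝔊, Θ * Z = Z → Z * Θ = -Z → Z ≠ 0 → Module.finrank ℂ (LinearMap.range B) ≤ Module.finrank ℂ (LinearMap.range Z) := by
    rw [hr]; exact hmin
  obtain ⟨ι, Um, Up, PU, QU, Lm, ιm, Pm, Qm, Lp, ιp, Pp, Qp, hιmem, hιι, hιΘ, hιs, hUm, hUp, hfinUm, hfinUp,
    hPM, hQM, hPU, hQU, hrangeP, hPUP, hQUQ, hfinQM, hfinPU, hfinQU, hLm, hLp,
    hιmapply, hPmmem, hQmmem, hbrLm, hirrLm, hιmmem, hιmιm, hPm, hQm, hfinPm, hfinQm, hPmQm, hdefPm, hdefQm, hadjLm,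
    hιpapply, hPpmem, hQpmem, hbrLp, hirrLp, hιpmem, hιpιp, hPp, hQp, hfinPp, hfinQp, hPpQp, hdefPp, hdefQp, hadjLp,
    hsplit⟩ :=
    UnitaryLeviSetup.exists_levi_pair hbr hirr hΘ hΘΘ hP hQ hadd hsymm hPQ hdefP hdefQ hadj hB hΘB hBΘ
  have hdich : ∀ X ∈ 𝔊, Θ * X = X → X * Θ = -X → X * ι = ι * X →
      Module.finrank ℂ (Up.map X) + Module.finrank ℂ (Um.map X) ≤ Module.finrank ℂ (LinearMap.range B) ∨
        (19 ≤ Module.finrank ℂ (Up.map X) ∧ 19 ≤ Module.finrank ℂ (Um.map X)) := fun X hX hΘX hXΘ hXc =>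
    UnitaryLeviSetup.profile_dichotomy hbr hΘΘ hP hQ hadd hsymm hPQ hdefP hdefQ hadj hmin hB hΘB hBΘ hιι hιΘ hιs hUm hUp
      hPM hQM hQU hfinQU hrangeP hX hΘX hXΘ hXc
  have hfinQU' := hfinQU
  rw [hr] at hfinQM hfinPU hfinQU hfinPm hfinQm hfinPp hfinQp hsplit hdich
  rw [hQ35] at hfinQM hfinQm hfinUm
  rw [hP32] at hfinPU hfinPp hfinUp
  have hcm : ∀ Z : Module.End ℂ W, Z * ι = ι * Z → ∀ x ∈ Um, Z x ∈ Um := fun Z hZ x hx =>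
    (hUm _).2 (by rw [← Module.End.mul_apply, ← hZ, Module.End.mul_apply, (hUm x).1 hx, map_neg])
  have hcp : ∀ Z : Module.End ℂ W, Z * ι = ι * Z → ∀ x ∈ Up, Z x ∈ Up := fun Z hZ x hx =>
    (hUp _).2 (by rw [← Module.End.mul_apply, ← hZ, Module.End.mul_apply, (hUp x).1 hx])
  have hfullm_of : Lm = ⊤ → False := fun h =>
    UnitaryLeviSetup.false_of_full_larger hbr hΘΘ hno1 hιι hιΘ hUm hUp (by omega) (by omega) hPM hQM (by omega)
      (by omega) hLm h
  have hLptop : Lp = ⊤ :=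
    UnitaryThirteen.eq_top_of_smul hbrLp hirrLp hιpmem hιpιp hPp hQp (by omega) (by omega) (s := fun x y : Up => s (x : W) y) (fun x y z => by simp only [Submodule.coe_add, hadd]) (fun c x y => by simp only [Submodule.coe_smul, hsmul]) (fun x y => hsymm _ _) hPpQp hdefPp hdefQp hadjLp
  obtain ⟨T1, hιT1, hT1ι, hT1r⟩ := UnitaryRaisingSpace.exists_raise_finrank_range_eq hιpιp hPp hQp (k := 1)
    (by omega) (by omega)
  obtain ⟨X1, hX1, hΘX1, hX1Θ, hX1c, hX1Up⟩ := UnitaryLeviSetup.exists_lift hbr hΘ hΘΘ hcp hιΘ hLp hιpapply T1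
    (by rw [hLptop]; exact Submodule.mem_top) hιT1 hT1ι
  rw [hT1r] at hX1Up
  obtain ⟨hs1, hi1, hi1', hj1, hj1'⟩ := hsplit X1 hΘX1 hX1Θ hX1c
  have hrk1 := hS X1 hX1 hΘX1 hX1Θ
  have hd1 := hdich X1 hX1 hΘX1 hX1Θ hX1c
  rw [hs1] at hrk1
  rw [hX1Up] at hrk1 hd1
  omega

/-- `(32 | 35)`, minimal rank `20`: the non-zero profiles [(5, 15), (6, 14), (8, 12), (10, 10), (12, 8)] are pairwise exclusive, so constant; `(5, 15)`: `L⁺` (type `(12 | 20)`) has constant rank `5`; `(6, 14)`: `L⁺` (type `(12 | 20)`) has constant rank `6`; `(8, 12)`: `L⁺` (type `(12 | 20)`) has constant rank `8`; `(10, 10)`: TOOL G; `(12, 8)`: TOOL G. [cite: Ribet1983, Thm. 3] [cite: Gordon1997, Thm. 6.3 (3)]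
[cite: Deligne1982HodgeCycles, I §3 Prop. 3.4, 3.6] [cite: GoodmanWallachGTM255, §4.1.1] -/
theorem UnitaryThirtyTwoThirtyFive.no_minRank_20 [FiniteDimensional ℂ W] {𝔊 : Submodule ℂ (Module.End ℂ W)}
    (hbr : ∀ Y ∈ 𝔊, ∀ Z ∈ 𝔊, Y * Z - Z * Y ∈ 𝔊)
    (hirr : ∀ U : Submodule ℂ W, (∀ A ∈ 𝔊, ∀ u ∈ U, A u ∈ U) → U = ⊥ ∨ U = ⊤)
    {Θ : Module.End ℂ W} (hΘ : Θ ∈ 𝔊) (hΘΘ : Θ * Θ = 1)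
    {P Q : Submodule ℂ W} (hP : ∀ x, x ∈ P ↔ Θ x = x) (hQ : ∀ x, x ∈ Q ↔ Θ x = -x)
    (hP32 : Module.finrank ℂ P = 32) (hQ35 : Module.finrank ℂ Q = 35)
    {s : W → W → ℂ} (hadd : ∀ x y z, s (x + y) z = s x z + s y z)
    (hsmul : ∀ (c : ℂ) (x y : W), s (c • x) y = c * s x y) (hsymm : ∀ x y, s y x = starRingEnd ℂ (s x y))
    (hPQ : ∀ p ∈ P, ∀ q ∈ Q, s p q = 0) (hdefP : ∀ p ∈ P, s p p = 0 → p = 0) (hdefQ : ∀ q ∈ Q, s q q = 0 → q = 0)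
    (hadj : ∀ X ∈ 𝔊, ∃ Y ∈ 𝔊, ∀ x y, s (X x) y = s x (Y y))
    (hS : ∀ B' ∈ 𝔊, Θ * B' = B' → B' * Θ = -B' →
      Module.finrank ℂ (LinearMap.range B') = 0 ∨ Module.finrank ℂ (LinearMap.range B') = 20 ∨ Module.finrank ℂ (LinearMap.range B') = 21 ∨ Module.finrank ℂ (LinearMap.range B') = 23 ∨ Module.finrank ℂ (LinearMap.range B') = 25 ∨ Module.finrank ℂ (LinearMap.range B') = 26 ∨ Module.finrank ℂ (LinearMap.range B') = 27 ∨ Module.finrank ℂ (LinearMap.range B') = 28 ∨ Module.finrank ℂ (LinearMap.range B') = 30)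
    {B : Module.End ℂ W} (hB : B ∈ 𝔊) (hΘB : Θ * B = B) (hBΘ : B * Θ = -B)
    (hr : Module.finrank ℂ (LinearMap.range B) = 20) : False := by
  classical
  have hsU : ∀ U : Submodule ℂ W, ∀ x y z : U, s ((x + y : U) : W) z = s (x : W) z + s (y : W) z :=
    fun U x y z => by simp only [Submodule.coe_add, hadd]
  have hsmU : ∀ U : Submodule ℂ W, ∀ (c : ℂ) (x y : U), s ((c • x : U) : W) y = c * s (x : W) y :=
    fun U c x y => by simp only [Submodule.coe_smul, hsmul]
  have hno1 : ∀ B' ∈ 𝔊, Θ * B' = B' → B' * Θ = -B' → Module.finrank ℂ (LinearMap.range B') ≠ 1 := by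
    intro B' hB' hΘB' hB'Θ h1
    rcases hS B' hB' hΘB' hB'Θ with h | h | h | h | h | h | h | h | h <;> omega
  have hmin : ∀ Y ∈ 𝔊, Θ * Y = Y → Y * Θ = -Y → Y ≠ 0 → 20 ≤ Module.finrank ℂ (LinearMap.range Y) := by
    intro Y hY hΘY hYΘ hY0
    have h0 : Module.finrank ℂ (LinearMap.range Y) ≠ 0 := fun h =>
      hY0 (LinearMap.range_eq_bot.1 (Submodule.finrank_eq_zero.1 h))
    rcases hS Y hY hΘY hYΘ with h | h | h | h | h | h | h | h | h <;> omega
  have hmin' : ∀ Z ∈ 𝔊, Θ * Z = Z → Z * Θ = -Z → Z ≠ 0 → Module.finrank ℂ (LinearMap.range B) ≤ Module.finrank ℂ (LinearMap.range Z) := by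
    rw [hr]; exact hmin
  obtain ⟨ι, Um, Up, PU, QU, Lm, ιm, Pm, Qm, Lp, ιp, Pp, Qp, hιmem, hιι, hιΘ, hιs, hUm, hUp, hfinUm, hfinUp,
    hPM, hQM, hPU, hQU, hrangeP, hPUP, hQUQ, hfinQM, hfinPU, hfinQU, hLm, hLp,
    hιmapply, hPmmem, hQmmem, hbrLm, hirrLm, hιmmem, hιmιm, hPm, hQm, hfinPm, hfinQm, hPmQm, hdefPm, hdefQm, hadjLm,
    hιpapply, hPpmem, hQpmem, hbrLp, hirrLp, hιpmem, hιpιp, hPp, hQp, hfinPp, hfinQp, hPpQp, hdefPp, hdefQp, hadjLp,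
    hsplit⟩ :=
    UnitaryLeviSetup.exists_levi_pair hbr hirr hΘ hΘΘ hP hQ hadd hsymm hPQ hdefP hdefQ hadj hB hΘB hBΘ
  have hdich : ∀ X ∈ 𝔊, Θ * X = X → X * Θ = -X → X * ι = ι * X →
      Module.finrank ℂ (Up.map X) + Module.finrank ℂ (Um.map X) ≤ Module.finrank ℂ (LinearMap.range B) ∨
        (20 ≤ Module.finrank ℂ (Up.map X) ∧ 20 ≤ Module.finrank ℂ (Um.map X)) := fun X hX hΘX hXΘ hXc =>
    UnitaryLeviSetup.profile_dichotomy hbr hΘΘ hP hQ hadd hsymm hPQ hdefP hdefQ hadj hmin hB hΘB hBΘ hιι hιΘ hιs hUm hUp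
      hPM hQM hQU hfinQU hrangeP hX hΘX hXΘ hXc
  have hfinQU' := hfinQU
  rw [hr] at hfinQM hfinPU hfinQU hfinPm hfinQm hfinPp hfinQp hsplit hdich
  rw [hQ35] at hfinQM hfinQm hfinUm
  rw [hP32] at hfinPU hfinPp hfinUp
  have hcm : ∀ Z : Module.End ℂ W, Z * ι = ι * Z → ∀ x ∈ Um, Z x ∈ Um := fun Z hZ x hx =>
    (hUm _).2 (by rw [← Module.End.mul_apply, ← hZ, Module.End.mul_apply, (hUm x).1 hx, map_neg])
  have hcp : ∀ Z : Module.End ℂ W, Z * ι = ι * Z → ∀ x ∈ Up, Z x ∈ Up := fun Z hZ x hx =>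
    (hUp _).2 (by rw [← Module.End.mul_apply, ← hZ, Module.End.mul_apply, (hUp x).1 hx])
  have hfullm_of : Lm = ⊤ → False := fun h =>
    UnitaryLeviSetup.false_of_full_larger hbr hΘΘ hno1 hιι hιΘ hUm hUp (by omega) (by omega) hPM hQM (by omega)
      (by omega) hLm h
  have hkillm9 : ∀ X ∈ 𝔊, Θ * X = X → X * Θ = -X → X * ι = ι * X → Module.finrank ℂ (Um.map X) ≠ 9 := by
    intro X hX hΘX hXΘ hXc h9
    obtain ⟨hxmem, hιmx, hxιm, hxrk⟩ := UnitaryLeviSetup.restrict_mem hcm hLm hιmapply X hX hΘX hXΘ hXc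
    rw [h9] at hxrk
    refine hfullm_of (UnitaryDoubleLevi.eq_top_of_raise_of_core' hbrLm hirrLm hιmmem hιmιm hPm hQm
      (s := fun v w : Um => s (v : W) w) (hsU Um) (fun v w => hsymm v w) hPmQm hdefPm hdefQm hadjLm hxmem hιmx hxιm
      (by rw [hxrk]; omega) (by omega) (by omega)
      fun U' 𝔩' ι' P' Q' hbr𝔩' hirr𝔩' hι' hι'ι' hP' hQ' hfinP' hfinQ' hP'Q' hdefP' hdefQ' hadj𝔩' => ?_)
    rw [hxrk] at hfinP' hfinQ'
    exact UnitaryEleven.eq_top_of_smul' hbr𝔩' hirr𝔩' hι' hι'ι' hP' hQ' (by omega) (by omega) (s := fun x y : U' => s ((x : Um) : W) y) (fun x y z => by simp only [Submodule.coe_add, hadd]) (fun c x y => by simp only [Submodule.coe_smul, hsmul]) (fun x y => hsymm _ _) hP'Q' hdefP' hdefQ' hadj𝔩'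
  have hkillm11 : ∀ X ∈ 𝔊, Θ * X = X → X * Θ = -X → X * ι = ι * X → Module.finrank ℂ (Um.map X) ≠ 11 := by
    intro X hX hΘX hXΘ hXc h11
    obtain ⟨hxmem, hιmx, hxιm, hxrk⟩ := UnitaryLeviSetup.restrict_mem hcm hLm hιmapply X hX hΘX hXΘ hXc
    rw [h11] at hxrk
    refine hfullm_of (UnitaryDoubleLevi.eq_top_of_raise_of_core' hbrLm hirrLm hιmmem hιmιm hPm hQm
      (s := fun v w : Um => s (v : W) w) (hsU Um) (fun v w => hsymm v w) hPmQm hdefPm hdefQm hadjLm hxmem hιmx hxιm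
      (by rw [hxrk]; omega) (by omega) (by omega)
      fun U' 𝔩' ι' P' Q' hbr𝔩' hirr𝔩' hι' hι'ι' hP' hQ' hfinP' hfinQ' hP'Q' hdefP' hdefQ' hadj𝔩' => ?_)
    rw [hxrk] at hfinP' hfinQ'
    exact UnitaryEleven.eq_top_of_smul hbr𝔩' hirr𝔩' hι' hι'ι' hP' hQ' hfinP' (by omega) (s := fun x y : U' => s ((x : Um) : W) y) (fun x y z => by simp only [Submodule.coe_add, hadd]) (fun c x y => by simp only [Submodule.coe_smul, hsmul]) (fun x y => hsymm _ _) hP'Q' hdefP' hdefQ' hadj𝔩'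
  have hkillm13 : ∀ X ∈ 𝔊, Θ * X = X → X * Θ = -X → X * ι = ι * X → Module.finrank ℂ (Um.map X) ≠ 13 := by
    intro X hX hΘX hXΘ hXc h13
    obtain ⟨hxmem, hιmx, hxιm, hxrk⟩ := UnitaryLeviSetup.restrict_mem hcm hLm hιmapply X hX hΘX hXΘ hXc
    rw [h13] at hxrk
    refine hfullm_of (UnitaryDoubleLevi.eq_top_of_raise_of_core' hbrLm hirrLm hιmmem hιmιm hPm hQm
      (s := fun v w : Um => s (v : W) w) (hsU Um) (fun v w => hsymm v w) hPmQm hdefPm hdefQm hadjLm hxmem hιmx hxιm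
      (by rw [hxrk]; omega) (by omega) (by omega)
      fun U' 𝔩' ι' P' Q' hbr𝔩' hirr𝔩' hι' hι'ι' hP' hQ' hfinP' hfinQ' hP'Q' hdefP' hdefQ' hadj𝔩' => ?_)
    rw [hxrk] at hfinP' hfinQ'
    exact UnitarySeven.eq_top_of_smul' hbr𝔩' hirr𝔩' hι' hι'ι' hP' hQ' (by omega) (by omega) (s := fun x y : U' => s ((x : Um) : W) y) (fun x y z => by simp only [Submodule.coe_add, hadd]) (fun c x y => by simp only [Submodule.coe_smul, hsmul]) (fun x y => hsymm _ _) hP'Q' hdefP' hdefQ' hadj𝔩'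
  have hfullp_of : Lp = ⊤ → False := by
    intro hLptop
    obtain ⟨T1, hιT1, hT1ι, hT1r⟩ := UnitaryRaisingSpace.exists_raise_finrank_range_eq hιpιp hPp hQp (k := 1)
      (by omega) (by omega)
    obtain ⟨X1, hX1, hΘX1, hX1Θ, hX1c, hX1Up⟩ := UnitaryLeviSetup.exists_lift hbr hΘ hΘΘ hcp hιΘ hLp hιpapply T1
      (by rw [hLptop]; exact Submodule.mem_top) hιT1 hT1ι
    rw [hT1r] at hX1Up
    obtain ⟨hs1, hi1, hi1', hj1, hj1'⟩ := hsplit X1 hΘX1 hX1Θ hX1c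
    have hrk1 := hS X1 hX1 hΘX1 hX1Θ
    have hd1 := hdich X1 hX1 hΘX1 hX1Θ hX1c
    rw [hs1] at hrk1
    rw [hX1Up] at hrk1 hd1
    omega
  have hprof : ∀ X ∈ 𝔊, Θ * X = X → X * Θ = -X → X * ι = ι * X →
      (Module.finrank ℂ (Up.map X) = 0 ∧ Module.finrank ℂ (Um.map X) = 0) ∨
        (Module.finrank ℂ (Up.map X) = 5 ∧ Module.finrank ℂ (Um.map X) = 15) ∨
        (Module.finrank ℂ (Up.map X) = 6 ∧ Module.finrank ℂ (Um.map X) = 14) ∨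
        (Module.finrank ℂ (Up.map X) = 8 ∧ Module.finrank ℂ (Um.map X) = 12) ∨
        (Module.finrank ℂ (Up.map X) = 10 ∧ Module.finrank ℂ (Um.map X) = 10) ∨
        (Module.finrank ℂ (Up.map X) = 12 ∧ Module.finrank ℂ (Um.map X) = 8) := by
    intro X hX hΘX hXΘ hXc
    obtain ⟨hs, hi, hi', hj, hj'⟩ := hsplit X hΘX hXΘ hXc
    have hkillm9' := hkillm9 X hX hΘX hXΘ hXc
    have hkillm11' := hkillm11 X hX hΘX hXΘ hXc
    have hkillm13' := hkillm13 X hX hΘX hXΘ hXc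
    have hrk := hS X hX hΘX hXΘ
    have hd := hdich X hX hΘX hXΘ hXc
    rw [hs] at hrk
    generalize Module.finrank ℂ ↥(Submodule.map X Um) = jj at *
    have hjle : jj ≤ 15 := by omega
    interval_cases jj
    · exact Or.inl ⟨by omega, rfl⟩
    · exfalso; omega
    · exfalso; omega
    · exfalso; omega
    · exfalso; omega
    · exfalso; omega
    · exfalso; omega
    · exfalso; omega
    · exact Or.inr (Or.inr (Or.inr (Or.inr (Or.inr (⟨by omega, rfl⟩)))))
    · exact (hkillm9' rfl).elim
    · exact Or.inr (Or.inr (Or.inr (Or.inr (Or.inl ⟨by omega, rfl⟩))))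
    · exact (hkillm11' rfl).elim
    · exact Or.inr (Or.inr (Or.inr (Or.inl ⟨by omega, rfl⟩)))
    · exact (hkillm13' rfl).elim
    · exact Or.inr (Or.inr (Or.inl ⟨by omega, rfl⟩))
    · exact Or.inr (Or.inl ⟨by omega, rfl⟩)
  obtain ⟨⟨p, hp⟩, hp0⟩ := Module.finrank_pos_iff_exists_ne_zero.1 (show 0 < Module.finrank ℂ PU by omega)
  obtain ⟨⟨q, hq⟩, hq0⟩ := Module.finrank_pos_iff_exists_ne_zero.1 (show 0 < Module.finrank ℂ QU by omega)
  obtain ⟨X₀, hX₀, hΘX₀, hX₀Θ, hX₀c, c₀, hιc₀, -, hX₀c0⟩ :=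
    UnitaryLeviFull.exists_raise_commute_apply_ne_zero hbr hirr hΘ hΘΘ hQ hιmem hιι hιΘ hUm hUp
      ⟨p, fun h => hp0 (Subtype.ext h), ((hPU p).1 hp).1, ((hPU p).1 hp).2⟩
      ⟨q, fun h => hq0 (Subtype.ext h), ((hQU q).1 hq).1, ((hQU q).1 hq).2⟩
  have hX₀i : Module.finrank ℂ (Up.map X₀) ≠ 0 := fun h0 => by
    have hmem : X₀ c₀ ∈ Up.map X₀ := Submodule.mem_map_of_mem ((hUp c₀).2 hιc₀)
    rw [Submodule.finrank_eq_zero.1 h0, Submodule.mem_bot] at hmem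
    exact hX₀c0 hmem
  have hnotboth : ∀ X ∈ 𝔊, Θ * X = X → X * Θ = -X → X * ι = ι * X → ∀ X' ∈ 𝔊, Θ * X' = X' → X' * Θ = -X' →
      X' * ι = ι * X' → 20 < Module.finrank ℂ (Up.map X') + Module.finrank ℂ (Um.map X) → False := by
    intro X hX hΘX hXΘ hXc X' hX' hΘX' hX'Θ hX'c hgt
    obtain ⟨c, hc1, hc2⟩ := UnitaryGenericRank.exists_finrank_le_and_finrank_le (X'.restrict (hcp X' hX'c))
      (X.restrict (hcp X hXc)) (X.restrict (hcm X hXc)) (X'.restrict (hcm X' hX'c))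
    obtain ⟨hX₁, hΘX₁, hX₁Θ, hX₁c⟩ := UnitaryLeviSetup.add_smul_raise X hX hΘX hXΘ hXc X' hX' hΘX' hX'Θ hX'c c
    have hi₁ := UnitaryLeviSetup.finrank_map_add_smul hcp X X' hXc hX'c c hX₁c
    have hj₁ := UnitaryLeviSetup.finrank_map_add_smul hcm X X' hXc hX'c c hX₁c
    rw [UnitaryLeviRank.finrank_range_restrict] at hc1 hc2
    have hp := hprof (X + c • X') hX₁ hΘX₁ hX₁Θ hX₁c
    rw [hi₁, hj₁] at hp
    omega
  have hzero : ∀ X ∈ 𝔊, Θ * X = X → X * Θ = -X → X * ι = ι * X → Module.finrank ℂ (Up.map X) = 0 → Module.finrank ℂ (Um.map X) = 0 → X = 0 := by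
    intro X hX hΘX hXΘ hXc hi hj
    obtain ⟨hs, -, -, -, -⟩ := hsplit X hΘX hXΘ hXc
    rw [hi, hj, add_zero] at hs
    exact LinearMap.range_eq_bot.1 (Submodule.finrank_eq_zero.1 hs)
  have hjoint : ∀ v ∈ Q ⊓ LinearMap.ker B,
      (∀ X ∈ 𝔊, Θ * X = X → X * Θ = -X → X * ι = ι * X → X v = 0) → v = 0 := by
    intro v hv hkill
    obtain ⟨hιv, -⟩ := (hQM v).1 hv
    have hvUm : v ∈ Um := (hUm v).2 hιv
    obtain ⟨⟨p₁, hp₁⟩, hp₁0⟩ := Module.finrank_pos_iff_exists_ne_zero.1 (show 0 < Module.finrank ℂ Pm by omega)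
    have hq : ιm ⟨v, hvUm⟩ = -⟨v, hvUm⟩ := (hQm _).1 ((hQmmem _).2 hv)
    have h0 := UnitaryThetaCore.eq_zero_of_forall_raise_apply_eq_zero hbrLm hirrLm hιmmem hιmιm
      ⟨p₁, fun h => hp₁0 (Subtype.ext h), (hPm p₁).1 hp₁⟩ hq fun T hT hιT hTι => ?_
    · exact congrArg Subtype.val h0
    obtain ⟨X, hX, hΘX, hXΘ, hXc, hXT⟩ := UnitaryLeviSetup.exists_lift_eq hbr hΘ hΘΘ hιΘ hLm hιmapply T hT hιT hTι
    exact Subtype.ext (by rw [← hXT]; exact hkill X hX hΘX hXΘ hXc)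
  rcases hprof X₀ hX₀ hΘX₀ hX₀Θ hX₀c with ⟨h0i, h0j⟩ | ⟨h0i, h0j⟩ | ⟨h0i, h0j⟩ | ⟨h0i, h0j⟩ | ⟨h0i, h0j⟩ | ⟨h0i, h0j⟩
  · exact hX₀i h0i
  · -- constant profile `(5, 15)`
    have hprofc : ∀ X ∈ 𝔊, Θ * X = X → X * Θ = -X → X * ι = ι * X → X ≠ 0 →
        Module.finrank ℂ (Up.map X) = 5 ∧ Module.finrank ℂ (Um.map X) = 15 := by
      intro X hX hΘX hXΘ hXc hX0
      rcases hprof X hX hΘX hXΘ hXc with ⟨hi, hj⟩ | ⟨hi, hj⟩ | ⟨hi, hj⟩ | ⟨hi, hj⟩ | ⟨hi, hj⟩ | ⟨hi, hj⟩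
      · exact (hX0 (hzero X hX hΘX hXΘ hXc hi hj)).elim
      · exact ⟨hi, hj⟩
      · exact (hnotboth X₀ hX₀ hΘX₀ hX₀Θ hX₀c X hX hΘX hXΘ hXc (by omega)).elim
      · exact (hnotboth X₀ hX₀ hΘX₀ hX₀Θ hX₀c X hX hΘX hXΘ hXc (by omega)).elim
      · exact (hnotboth X₀ hX₀ hΘX₀ hX₀Θ hX₀c X hX hΘX hXΘ hXc (by omega)).elim
      · exact (hnotboth X₀ hX₀ hΘX₀ hX₀Θ hX₀c X hX hΘX hXΘ hXc (by omega)).elim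
    obtain ⟨hymem, hιpy, hyιp, hyrk⟩ := UnitaryLeviSetup.restrict_mem hcp hLp hιpapply X₀ hX₀ hΘX₀ hX₀Θ hX₀c
    have hSp : ∀ A ∈ Lp, ιp * A = A → A * ιp = -A →
        Module.finrank ℂ (LinearMap.range A) = 0 ∨ Module.finrank ℂ (LinearMap.range A) = 5 := by
      intro A hA hιA hAι
      by_cases hA0 : A = 0
      · left; rw [hA0, LinearMap.range_zero, finrank_bot]
      · obtain ⟨XA, hXA, hΘXA, hXAΘ, hXAc, hXAUp⟩ :=
          UnitaryLeviSetup.exists_lift hbr hΘ hΘΘ hcp hιΘ hLp hιpapply A hA hιA hAι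
        have hXA0 : XA ≠ 0 := fun h0 => hA0 (LinearMap.range_eq_bot.1 (Submodule.finrank_eq_zero.1
          (by rw [← hXAUp, h0, Submodule.map_zero, finrank_bot])))
        right; rw [← hXAUp]; exact (hprofc XA hXA hΘXA hXAΘ hXAc hXA0).1
    exact UnitaryThirtyTwoThirtyFive.subTwelveTwenty_rank5 hbrLp hirrLp hιpmem hιpιp hPp hQp (by omega) (by omega)
      (s := fun v w : Up => s (v : W) w) (hsU Up) (hsmU Up) (fun v w => hsymm v w) hPpQp hdefPp hdefQp hadjLp hSp
      hymem hιpy hyιp (by rw [hyrk, h0i])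
  · -- constant profile `(6, 14)`
    have hprofc : ∀ X ∈ 𝔊, Θ * X = X → X * Θ = -X → X * ι = ι * X → X ≠ 0 →
        Module.finrank ℂ (Up.map X) = 6 ∧ Module.finrank ℂ (Um.map X) = 14 := by
      intro X hX hΘX hXΘ hXc hX0
      rcases hprof X hX hΘX hXΘ hXc with ⟨hi, hj⟩ | ⟨hi, hj⟩ | ⟨hi, hj⟩ | ⟨hi, hj⟩ | ⟨hi, hj⟩ | ⟨hi, hj⟩
      · exact (hX0 (hzero X hX hΘX hXΘ hXc hi hj)).elim
      · exact (hnotboth X hX hΘX hXΘ hXc X₀ hX₀ hΘX₀ hX₀Θ hX₀c (by omega)).elim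
      · exact ⟨hi, hj⟩
      · exact (hnotboth X₀ hX₀ hΘX₀ hX₀Θ hX₀c X hX hΘX hXΘ hXc (by omega)).elim
      · exact (hnotboth X₀ hX₀ hΘX₀ hX₀Θ hX₀c X hX hΘX hXΘ hXc (by omega)).elim
      · exact (hnotboth X₀ hX₀ hΘX₀ hX₀Θ hX₀c X hX hΘX hXΘ hXc (by omega)).elim
    obtain ⟨hymem, hιpy, hyιp, hyrk⟩ := UnitaryLeviSetup.restrict_mem hcp hLp hιpapply X₀ hX₀ hΘX₀ hX₀Θ hX₀c
    have hSp : ∀ A ∈ Lp, ιp * A = A → A * ιp = -A →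
        Module.finrank ℂ (LinearMap.range A) = 0 ∨ Module.finrank ℂ (LinearMap.range A) = 6 := by
      intro A hA hιA hAι
      by_cases hA0 : A = 0
      · left; rw [hA0, LinearMap.range_zero, finrank_bot]
      · obtain ⟨XA, hXA, hΘXA, hXAΘ, hXAc, hXAUp⟩ :=
          UnitaryLeviSetup.exists_lift hbr hΘ hΘΘ hcp hιΘ hLp hιpapply A hA hιA hAι
        have hXA0 : XA ≠ 0 := fun h0 => hA0 (LinearMap.range_eq_bot.1 (Submodule.finrank_eq_zero.1
          (by rw [← hXAUp, h0, Submodule.map_zero, finrank_bot])))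
        right; rw [← hXAUp]; exact (hprofc XA hXA hΘXA hXAΘ hXAc hXA0).1
    exact UnitaryThirtyTwoThirtyFive.subTwelveTwenty_rank6 hbrLp hirrLp hιpmem hιpιp hPp hQp (by omega) (by omega)
      (s := fun v w : Up => s (v : W) w) (hsU Up) (hsmU Up) (fun v w => hsymm v w) hPpQp hdefPp hdefQp hadjLp hSp
      hymem hιpy hyιp (by rw [hyrk, h0i])
  · -- constant profile `(8, 12)`
    have hprofc : ∀ X ∈ 𝔊, Θ * X = X → X * Θ = -X → X * ι = ι * X → X ≠ 0 →
        Module.finrank ℂ (Up.map X) = 8 ∧ Module.finrank ℂ (Um.map X) = 12 := by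
      intro X hX hΘX hXΘ hXc hX0
      rcases hprof X hX hΘX hXΘ hXc with ⟨hi, hj⟩ | ⟨hi, hj⟩ | ⟨hi, hj⟩ | ⟨hi, hj⟩ | ⟨hi, hj⟩ | ⟨hi, hj⟩
      · exact (hX0 (hzero X hX hΘX hXΘ hXc hi hj)).elim
      · exact (hnotboth X hX hΘX hXΘ hXc X₀ hX₀ hΘX₀ hX₀Θ hX₀c (by omega)).elim
      · exact (hnotboth X hX hΘX hXΘ hXc X₀ hX₀ hΘX₀ hX₀Θ hX₀c (by omega)).elim
      · exact ⟨hi, hj⟩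
      · exact (hnotboth X₀ hX₀ hΘX₀ hX₀Θ hX₀c X hX hΘX hXΘ hXc (by omega)).elim
      · exact (hnotboth X₀ hX₀ hΘX₀ hX₀Θ hX₀c X hX hΘX hXΘ hXc (by omega)).elim
    obtain ⟨hymem, hιpy, hyιp, hyrk⟩ := UnitaryLeviSetup.restrict_mem hcp hLp hιpapply X₀ hX₀ hΘX₀ hX₀Θ hX₀c
    have hSp : ∀ A ∈ Lp, ιp * A = A → A * ιp = -A →
        Module.finrank ℂ (LinearMap.range A) = 0 ∨ Module.finrank ℂ (LinearMap.range A) = 8 := by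
      intro A hA hιA hAι
      by_cases hA0 : A = 0
      · left; rw [hA0, LinearMap.range_zero, finrank_bot]
      · obtain ⟨XA, hXA, hΘXA, hXAΘ, hXAc, hXAUp⟩ :=
          UnitaryLeviSetup.exists_lift hbr hΘ hΘΘ hcp hιΘ hLp hιpapply A hA hιA hAι
        have hXA0 : XA ≠ 0 := fun h0 => hA0 (LinearMap.range_eq_bot.1 (Submodule.finrank_eq_zero.1
          (by rw [← hXAUp, h0, Submodule.map_zero, finrank_bot])))
        right; rw [← hXAUp]; exact (hprofc XA hXA hΘXA hXAΘ hXAc hXA0).1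
    exact UnitaryThirtyTwoThirtyFive.subTwelveTwenty_rank8 hbrLp hirrLp hιpmem hιpιp hPp hQp (by omega) (by omega)
      (s := fun v w : Up => s (v : W) w) (hsU Up) (hsmU Up) (fun v w => hsymm v w) hPpQp hdefPp hdefQp hadjLp hSp
      hymem hιpy hyιp (by rw [hyrk, h0i])
  · -- constant profile `(10, 10)`
    have hprofc : ∀ X ∈ 𝔊, Θ * X = X → X * Θ = -X → X * ι = ι * X → X ≠ 0 →
        Module.finrank ℂ (Up.map X) = 10 ∧ Module.finrank ℂ (Um.map X) = 10 := by
      intro X hX hΘX hXΘ hXc hX0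
      rcases hprof X hX hΘX hXΘ hXc with ⟨hi, hj⟩ | ⟨hi, hj⟩ | ⟨hi, hj⟩ | ⟨hi, hj⟩ | ⟨hi, hj⟩ | ⟨hi, hj⟩
      · exact (hX0 (hzero X hX hΘX hXΘ hXc hi hj)).elim
      · exact (hnotboth X hX hΘX hXΘ hXc X₀ hX₀ hΘX₀ hX₀Θ hX₀c (by omega)).elim
      · exact (hnotboth X hX hΘX hXΘ hXc X₀ hX₀ hΘX₀ hX₀Θ hX₀c (by omega)).elim
      · exact (hnotboth X hX hΘX hXΘ hXc X₀ hX₀ hΘX₀ hX₀Θ hX₀c (by omega)).elim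
      · exact ⟨hi, hj⟩
      · exact (hnotboth X₀ hX₀ hΘX₀ hX₀Θ hX₀c X hX hΘX hXΘ hXc (by omega)).elim
    have hnum0 : Module.finrank ℂ QU ≤ (fun t : ℕ => (max (max (20 - 10 * t) (18 - 8 * t)) (6 - 2 * t))) 0 := by beta_reduce; omega
    have hnum1 : (fun t : ℕ => (min (min (10 * t) (2 * t + 8)) 12)) 0 = 0 := by beta_reduce; omega
    have hnum2 : ∀ t : ℕ, (fun t : ℕ => (max (max (20 - 10 * t) (18 - 8 * t)) (6 - 2 * t))) t ≤ (fun t : ℕ => (max (max (20 - 10 * t) (18 - 8 * t)) (6 - 2 * t))) (t + 1) + (Module.finrank ℂ PU - (t + 1) * 2) := by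
      intro t; beta_reduce; omega
    have hnum3 : ∀ t : ℕ, (fun t : ℕ => (min (min (10 * t) (2 * t + 8)) 12)) t + (fun t : ℕ => (max (max (20 - 10 * t) (18 - 8 * t)) (6 - 2 * t))) (t + 1) ≤ (fun t : ℕ => (min (min (10 * t) (2 * t + 8)) 12)) (t + 1) := by
      intro t; beta_reduce; omega
    have hnum4 : ∀ t : ℕ, (fun t : ℕ => (min (min (10 * t) (2 * t + 8)) 12)) t < Module.finrank ℂ ↥(Q ⊓ LinearMap.ker B) := by
      intro t; beta_reduce; omega
    exact UnitaryOrthogonalChain.false_of_constProfile_pos hbr hΘΘ hP hQ hadd hsmul hsymm hPQ hdefP hdefQ hadj hB hΘB hBΘ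
      hmin' hιι hιΘ hιs hUm hUp hPM hQM hPU hQU hfinQU' (i := 10) (j := 10) (c := 2) hprofc (by omega) (by omega)
      (by omega) (fun t : ℕ => (max (max (20 - 10 * t) (18 - 8 * t)) (6 - 2 * t))) (fun t : ℕ => (min (min (10 * t) (2 * t + 8)) 12)) hnum0 hnum1 hnum2 hnum3 hnum4 hjoint
  · -- constant profile `(12, 8)`
    have hprofc : ∀ X ∈ 𝔊, Θ * X = X → X * Θ = -X → X * ι = ι * X → X ≠ 0 →
        Module.finrank ℂ (Up.map X) = 12 ∧ Module.finrank ℂ (Um.map X) = 8 := by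
      intro X hX hΘX hXΘ hXc hX0
      rcases hprof X hX hΘX hXΘ hXc with ⟨hi, hj⟩ | ⟨hi, hj⟩ | ⟨hi, hj⟩ | ⟨hi, hj⟩ | ⟨hi, hj⟩ | ⟨hi, hj⟩
      · exact (hX0 (hzero X hX hΘX hXΘ hXc hi hj)).elim
      · exact (hnotboth X hX hΘX hXΘ hXc X₀ hX₀ hΘX₀ hX₀Θ hX₀c (by omega)).elim
      · exact (hnotboth X hX hΘX hXΘ hXc X₀ hX₀ hΘX₀ hX₀Θ hX₀c (by omega)).elim
      · exact (hnotboth X hX hΘX hXΘ hXc X₀ hX₀ hΘX₀ hX₀Θ hX₀c (by omega)).elim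
      · exact (hnotboth X hX hΘX hXΘ hXc X₀ hX₀ hΘX₀ hX₀Θ hX₀c (by omega)).elim
      · exact ⟨hi, hj⟩
    have hnum0 : Module.finrank ℂ QU ≤ (fun t : ℕ => (max (20 - 12 * t) (16 - 8 * t))) 0 := by beta_reduce; omega
    have hnum1 : (fun t : ℕ => (min (8 * t) 8)) 0 = 0 := by beta_reduce; omega
    have hnum2 : ∀ t : ℕ, (fun t : ℕ => (max (20 - 12 * t) (16 - 8 * t))) t ≤ (fun t : ℕ => (max (20 - 12 * t) (16 - 8 * t))) (t + 1) + (Module.finrank ℂ PU - (t + 1) * 0) := by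
      intro t; beta_reduce; omega
    have hnum3 : ∀ t : ℕ, (fun t : ℕ => (min (8 * t) 8)) t + (fun t : ℕ => (max (20 - 12 * t) (16 - 8 * t))) (t + 1) ≤ (fun t : ℕ => (min (8 * t) 8)) (t + 1) := by
      intro t; beta_reduce; omega
    have hnum4 : ∀ t : ℕ, (fun t : ℕ => (min (8 * t) 8)) t < Module.finrank ℂ ↥(Q ⊓ LinearMap.ker B) := by
      intro t; beta_reduce; omega
    exact UnitaryOrthogonalChain.false_of_constProfile_pos hbr hΘΘ hP hQ hadd hsmul hsymm hPQ hdefP hdefQ hadj hB hΘB hBΘ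
      hmin' hιι hιΘ hιs hUm hUp hPM hQM hPU hQU hfinQU' (i := 12) (j := 8) (c := 0) hprofc (by omega) (by omega)
      (by omega) (fun t : ℕ => (max (20 - 12 * t) (16 - 8 * t))) (fun t : ℕ => (min (8 * t) 8)) hnum0 hnum1 hnum2 hnum3 hnum4 hjoint

/-- `(32 | 35)`, minimal rank `21`: `L⁺` of type `(11 | 21)` is full and a lift with `i = 1` has no feasible `j`. [cite: Ribet1983, Thm. 3] [cite: Gordon1997, Thm. 6.3 (3)]
[cite: Deligne1982HodgeCycles, I §3 Prop. 3.4, 3.6] [cite: GoodmanWallachGTM255, §4.1.1] -/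
theorem UnitaryThirtyTwoThirtyFive.no_minRank_21 [FiniteDimensional ℂ W] {𝔊 : Submodule ℂ (Module.End ℂ W)}
    (hbr : ∀ Y ∈ 𝔊, ∀ Z ∈ 𝔊, Y * Z - Z * Y ∈ 𝔊)
    (hirr : ∀ U : Submodule ℂ W, (∀ A ∈ 𝔊, ∀ u ∈ U, A u ∈ U) → U = ⊥ ∨ U = ⊤)
    {Θ : Module.End ℂ W} (hΘ : Θ ∈ 𝔊) (hΘΘ : Θ * Θ = 1)
    {P Q : Submodule ℂ W} (hP : ∀ x, x ∈ P ↔ Θ x = x) (hQ : ∀ x, x ∈ Q ↔ Θ x = -x)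
    (hP32 : Module.finrank ℂ P = 32) (hQ35 : Module.finrank ℂ Q = 35)
    {s : W → W → ℂ} (hadd : ∀ x y z, s (x + y) z = s x z + s y z)
    (hsmul : ∀ (c : ℂ) (x y : W), s (c • x) y = c * s x y) (hsymm : ∀ x y, s y x = starRingEnd ℂ (s x y))
    (hPQ : ∀ p ∈ P, ∀ q ∈ Q, s p q = 0) (hdefP : ∀ p ∈ P, s p p = 0 → p = 0) (hdefQ : ∀ q ∈ Q, s q q = 0 → q = 0)
    (hadj : ∀ X ∈ 𝔊, ∃ Y ∈ 𝔊, ∀ x y, s (X x) y = s x (Y y))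
    (hS : ∀ B' ∈ 𝔊, Θ * B' = B' → B' * Θ = -B' →
      Module.finrank ℂ (LinearMap.range B') = 0 ∨ Module.finrank ℂ (LinearMap.range B') = 21 ∨ Module.finrank ℂ (LinearMap.range B') = 23 ∨ Module.finrank ℂ (LinearMap.range B') = 25 ∨ Module.finrank ℂ (LinearMap.range B') = 26 ∨ Module.finrank ℂ (LinearMap.range B') = 27 ∨ Module.finrank ℂ (LinearMap.range B') = 28 ∨ Module.finrank ℂ (LinearMap.range B') = 30)
    {B : Module.End ℂ W} (hB : B ∈ 𝔊) (hΘB : Θ * B = B) (hBΘ : B * Θ = -B)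
    (hr : Module.finrank ℂ (LinearMap.range B) = 21) : False := by
  classical
  have hsU : ∀ U : Submodule ℂ W, ∀ x y z : U, s ((x + y : U) : W) z = s (x : W) z + s (y : W) z :=
    fun U x y z => by simp only [Submodule.coe_add, hadd]
  have hsmU : ∀ U : Submodule ℂ W, ∀ (c : ℂ) (x y : U), s ((c • x : U) : W) y = c * s (x : W) y :=
    fun U c x y => by simp only [Submodule.coe_smul, hsmul]
  have hno1 : ∀ B' ∈ 𝔊, Θ * B' = B' → B' * Θ = -B' → Module.finrank ℂ (LinearMap.range B') ≠ 1 := by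
    intro B' hB' hΘB' hB'Θ h1
    rcases hS B' hB' hΘB' hB'Θ with h | h | h | h | h | h | h | h <;> omega
  have hmin : ∀ Y ∈ 𝔊, Θ * Y = Y → Y * Θ = -Y → Y ≠ 0 → 21 ≤ Module.finrank ℂ (LinearMap.range Y) := by
    intro Y hY hΘY hYΘ hY0
    have h0 : Module.finrank ℂ (LinearMap.range Y) ≠ 0 := fun h =>
      hY0 (LinearMap.range_eq_bot.1 (Submodule.finrank_eq_zero.1 h))
    rcases hS Y hY hΘY hYΘ with h | h | h | h | h | h | h | h <;> omega
  have hmin' : ∀ Z ∈ 𝔊, Θ * Z = Z → Z * Θ = -Z → Z ≠ 0 → Module.finrank ℂ (LinearMap.range B) ≤ Module.finrank ℂ (LinearMap.range Z) := by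
    rw [hr]; exact hmin
  obtain ⟨ι, Um, Up, PU, QU, Lm, ιm, Pm, Qm, Lp, ιp, Pp, Qp, hιmem, hιι, hιΘ, hιs, hUm, hUp, hfinUm, hfinUp,
    hPM, hQM, hPU, hQU, hrangeP, hPUP, hQUQ, hfinQM, hfinPU, hfinQU, hLm, hLp,
    hιmapply, hPmmem, hQmmem, hbrLm, hirrLm, hιmmem, hιmιm, hPm, hQm, hfinPm, hfinQm, hPmQm, hdefPm, hdefQm, hadjLm,
    hιpapply, hPpmem, hQpmem, hbrLp, hirrLp, hιpmem, hιpιp, hPp, hQp, hfinPp, hfinQp, hPpQp, hdefPp, hdefQp, hadjLp,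
    hsplit⟩ :=
    UnitaryLeviSetup.exists_levi_pair hbr hirr hΘ hΘΘ hP hQ hadd hsymm hPQ hdefP hdefQ hadj hB hΘB hBΘ
  have hdich : ∀ X ∈ 𝔊, Θ * X = X → X * Θ = -X → X * ι = ι * X →
      Module.finrank ℂ (Up.map X) + Module.finrank ℂ (Um.map X) ≤ Module.finrank ℂ (LinearMap.range B) ∨
        (21 ≤ Module.finrank ℂ (Up.map X) ∧ 21 ≤ Module.finrank ℂ (Um.map X)) := fun X hX hΘX hXΘ hXc =>
    UnitaryLeviSetup.profile_dichotomy hbr hΘΘ hP hQ hadd hsymm hPQ hdefP hdefQ hadj hmin hB hΘB hBΘ hιι hιΘ hιs hUm hUp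
      hPM hQM hQU hfinQU hrangeP hX hΘX hXΘ hXc
  have hfinQU' := hfinQU
  rw [hr] at hfinQM hfinPU hfinQU hfinPm hfinQm hfinPp hfinQp hsplit hdich
  rw [hQ35] at hfinQM hfinQm hfinUm
  rw [hP32] at hfinPU hfinPp hfinUp
  have hcm : ∀ Z : Module.End ℂ W, Z * ι = ι * Z → ∀ x ∈ Um, Z x ∈ Um := fun Z hZ x hx =>
    (hUm _).2 (by rw [← Module.End.mul_apply, ← hZ, Module.End.mul_apply, (hUm x).1 hx, map_neg])
  have hcp : ∀ Z : Module.End ℂ W, Z * ι = ι * Z → ∀ x ∈ Up, Z x ∈ Up := fun Z hZ x hx =>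
    (hUp _).2 (by rw [← Module.End.mul_apply, ← hZ, Module.End.mul_apply, (hUp x).1 hx])
  have hfullm_of : Lm = ⊤ → False := fun h =>
    UnitaryLeviSetup.false_of_full_larger hbr hΘΘ hno1 hιι hιΘ hUm hUp (by omega) (by omega) hPM hQM (by omega)
      (by omega) hLm h
  have hLptop : Lp = ⊤ :=
    UnitaryEleven.eq_top_of_smul hbrLp hirrLp hιpmem hιpιp hPp hQp (by omega) (by omega) (s := fun x y : Up => s (x : W) y) (fun x y z => by simp only [Submodule.coe_add, hadd]) (fun c x y => by simp only [Submodule.coe_smul, hsmul]) (fun x y => hsymm _ _) hPpQp hdefPp hdefQp hadjLp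
  obtain ⟨T1, hιT1, hT1ι, hT1r⟩ := UnitaryRaisingSpace.exists_raise_finrank_range_eq hιpιp hPp hQp (k := 1)
    (by omega) (by omega)
  obtain ⟨X1, hX1, hΘX1, hX1Θ, hX1c, hX1Up⟩ := UnitaryLeviSetup.exists_lift hbr hΘ hΘΘ hcp hιΘ hLp hιpapply T1
    (by rw [hLptop]; exact Submodule.mem_top) hιT1 hT1ι
  rw [hT1r] at hX1Up
  obtain ⟨hs1, hi1, hi1', hj1, hj1'⟩ := hsplit X1 hΘX1 hX1Θ hX1c
  have hrk1 := hS X1 hX1 hΘX1 hX1Θ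
  have hd1 := hdich X1 hX1 hΘX1 hX1Θ hX1c
  rw [hs1] at hrk1
  rw [hX1Up] at hrk1 hd1
  omega

/-- `(32 | 35)`, minimal rank `23`: after the Levi kills every profile has `i = 0` (profiles [(0, 0)]), against the non-vanishing lemma. [cite: Ribet1983, Thm. 3] [cite: Gordon1997, Thm. 6.3 (3)]
[cite: Deligne1982HodgeCycles, I §3 Prop. 3.4, 3.6] [cite: GoodmanWallachGTM255, §4.1.1] -/
theorem UnitaryThirtyTwoThirtyFive.no_minRank_23 [FiniteDimensional ℂ W] {𝔊 : Submodule ℂ (Module.End ℂ W)}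
    (hbr : ∀ Y ∈ 𝔊, ∀ Z ∈ 𝔊, Y * Z - Z * Y ∈ 𝔊)
    (hirr : ∀ U : Submodule ℂ W, (∀ A ∈ 𝔊, ∀ u ∈ U, A u ∈ U) → U = ⊥ ∨ U = ⊤)
    {Θ : Module.End ℂ W} (hΘ : Θ ∈ 𝔊) (hΘΘ : Θ * Θ = 1)
    {P Q : Submodule ℂ W} (hP : ∀ x, x ∈ P ↔ Θ x = x) (hQ : ∀ x, x ∈ Q ↔ Θ x = -x)
    (hP32 : Module.finrank ℂ P = 32) (hQ35 : Module.finrank ℂ Q = 35)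
    {s : W → W → ℂ} (hadd : ∀ x y z, s (x + y) z = s x z + s y z)
    (hsmul : ∀ (c : ℂ) (x y : W), s (c • x) y = c * s x y) (hsymm : ∀ x y, s y x = starRingEnd ℂ (s x y))
    (hPQ : ∀ p ∈ P, ∀ q ∈ Q, s p q = 0) (hdefP : ∀ p ∈ P, s p p = 0 → p = 0) (hdefQ : ∀ q ∈ Q, s q q = 0 → q = 0)
    (hadj : ∀ X ∈ 𝔊, ∃ Y ∈ 𝔊, ∀ x y, s (X x) y = s x (Y y))
    (hS : ∀ B' ∈ 𝔊, Θ * B' = B' → B' * Θ = -B' →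
      Module.finrank ℂ (LinearMap.range B') = 0 ∨ Module.finrank ℂ (LinearMap.range B') = 23 ∨ Module.finrank ℂ (LinearMap.range B') = 25 ∨ Module.finrank ℂ (LinearMap.range B') = 26 ∨ Module.finrank ℂ (LinearMap.range B') = 27 ∨ Module.finrank ℂ (LinearMap.range B') = 28 ∨ Module.finrank ℂ (LinearMap.range B') = 30)
    {B : Module.End ℂ W} (hB : B ∈ 𝔊) (hΘB : Θ * B = B) (hBΘ : B * Θ = -B)
    (hr : Module.finrank ℂ (LinearMap.range B) = 23) : False := by
  classical
  have hsU : ∀ U : Submodule ℂ W, ∀ x y z : U, s ((x + y : U) : W) z = s (x : W) z + s (y : W) z :=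
    fun U x y z => by simp only [Submodule.coe_add, hadd]
  have hsmU : ∀ U : Submodule ℂ W, ∀ (c : ℂ) (x y : U), s ((c • x : U) : W) y = c * s (x : W) y :=
    fun U c x y => by simp only [Submodule.coe_smul, hsmul]
  have hno1 : ∀ B' ∈ 𝔊, Θ * B' = B' → B' * Θ = -B' → Module.finrank ℂ (LinearMap.range B') ≠ 1 := by
    intro B' hB' hΘB' hB'Θ h1
    rcases hS B' hB' hΘB' hB'Θ with h | h | h | h | h | h | h <;> omega
  have hmin : ∀ Y ∈ 𝔊, Θ * Y = Y → Y * Θ = -Y → Y ≠ 0 → 23 ≤ Module.finrank ℂ (LinearMap.range Y) := by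
    intro Y hY hΘY hYΘ hY0
    have h0 : Module.finrank ℂ (LinearMap.range Y) ≠ 0 := fun h =>
      hY0 (LinearMap.range_eq_bot.1 (Submodule.finrank_eq_zero.1 h))
    rcases hS Y hY hΘY hYΘ with h | h | h | h | h | h | h <;> omega
  have hmin' : ∀ Z ∈ 𝔊, Θ * Z = Z → Z * Θ = -Z → Z ≠ 0 → Module.finrank ℂ (LinearMap.range B) ≤ Module.finrank ℂ (LinearMap.range Z) := by
    rw [hr]; exact hmin
  obtain ⟨ι, Um, Up, PU, QU, Lm, ιm, Pm, Qm, Lp, ιp, Pp, Qp, hιmem, hιι, hιΘ, hιs, hUm, hUp, hfinUm, hfinUp,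
    hPM, hQM, hPU, hQU, hrangeP, hPUP, hQUQ, hfinQM, hfinPU, hfinQU, hLm, hLp,
    hιmapply, hPmmem, hQmmem, hbrLm, hirrLm, hιmmem, hιmιm, hPm, hQm, hfinPm, hfinQm, hPmQm, hdefPm, hdefQm, hadjLm,
    hιpapply, hPpmem, hQpmem, hbrLp, hirrLp, hιpmem, hιpιp, hPp, hQp, hfinPp, hfinQp, hPpQp, hdefPp, hdefQp, hadjLp,
    hsplit⟩ :=
    UnitaryLeviSetup.exists_levi_pair hbr hirr hΘ hΘΘ hP hQ hadd hsymm hPQ hdefP hdefQ hadj hB hΘB hBΘ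
  have hdich : ∀ X ∈ 𝔊, Θ * X = X → X * Θ = -X → X * ι = ι * X →
      Module.finrank ℂ (Up.map X) + Module.finrank ℂ (Um.map X) ≤ Module.finrank ℂ (LinearMap.range B) ∨
        (23 ≤ Module.finrank ℂ (Up.map X) ∧ 23 ≤ Module.finrank ℂ (Um.map X)) := fun X hX hΘX hXΘ hXc =>
    UnitaryLeviSetup.profile_dichotomy hbr hΘΘ hP hQ hadd hsymm hPQ hdefP hdefQ hadj hmin hB hΘB hBΘ hιι hιΘ hιs hUm hUp
      hPM hQM hQU hfinQU hrangeP hX hΘX hXΘ hXc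
  have hfinQU' := hfinQU
  rw [hr] at hfinQM hfinPU hfinQU hfinPm hfinQm hfinPp hfinQp hsplit hdich
  rw [hQ35] at hfinQM hfinQm hfinUm
  rw [hP32] at hfinPU hfinPp hfinUp
  have hcm : ∀ Z : Module.End ℂ W, Z * ι = ι * Z → ∀ x ∈ Um, Z x ∈ Um := fun Z hZ x hx =>
    (hUm _).2 (by rw [← Module.End.mul_apply, ← hZ, Module.End.mul_apply, (hUm x).1 hx, map_neg])
  have hcp : ∀ Z : Module.End ℂ W, Z * ι = ι * Z → ∀ x ∈ Up, Z x ∈ Up := fun Z hZ x hx =>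
    (hUp _).2 (by rw [← Module.End.mul_apply, ← hZ, Module.End.mul_apply, (hUp x).1 hx])
  have hfullm_of : Lm = ⊤ → False := fun h =>
    UnitaryLeviSetup.false_of_full_larger hbr hΘΘ hno1 hιι hιΘ hUm hUp (by omega) (by omega) hPM hQM (by omega)
      (by omega) hLm h
  have hfullp_of : Lp = ⊤ → False := by
    intro hLptop
    obtain ⟨T1, hιT1, hT1ι, hT1r⟩ := UnitaryRaisingSpace.exists_raise_finrank_range_eq hιpιp hPp hQp (k := 1)
      (by omega) (by omega)
    obtain ⟨X1, hX1, hΘX1, hX1Θ, hX1c, hX1Up⟩ := UnitaryLeviSetup.exists_lift hbr hΘ hΘΘ hcp hιΘ hLp hιpapply T1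
      (by rw [hLptop]; exact Submodule.mem_top) hιT1 hT1ι
    rw [hT1r] at hX1Up
    obtain ⟨hs1, hi1, hi1', hj1, hj1'⟩ := hsplit X1 hΘX1 hX1Θ hX1c
    have hrk1 := hS X1 hX1 hΘX1 hX1Θ
    have hd1 := hdich X1 hX1 hΘX1 hX1Θ hX1c
    rw [hs1] at hrk1
    rw [hX1Up] at hrk1 hd1
    omega
  have hprof : ∀ X ∈ 𝔊, Θ * X = X → X * Θ = -X → X * ι = ι * X →
      (Module.finrank ℂ (Up.map X) = 0 ∧ Module.finrank ℂ (Um.map X) = 0) := by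
    intro X hX hΘX hXΘ hXc
    obtain ⟨hs, hi, hi', hj, hj'⟩ := hsplit X hΘX hXΘ hXc

    have hrk := hS X hX hΘX hXΘ
    have hd := hdich X hX hΘX hXΘ hXc
    rw [hs] at hrk
    generalize Module.finrank ℂ ↥(Submodule.map X Um) = jj at *
    have hjle : jj ≤ 12 := by omega
    interval_cases jj
    · exact ⟨by omega, rfl⟩
    · exfalso; omega
    · exfalso; omega
    · exfalso; omega
    · exfalso; omega
    · exfalso; omega
    · exfalso; omega
    · exfalso; omega
    · exfalso; omega
    · exfalso; omega
    · exfalso; omega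
    · exfalso; omega
    · exfalso; omega
  obtain ⟨⟨p, hp⟩, hp0⟩ := Module.finrank_pos_iff_exists_ne_zero.1 (show 0 < Module.finrank ℂ PU by omega)
  obtain ⟨⟨q, hq⟩, hq0⟩ := Module.finrank_pos_iff_exists_ne_zero.1 (show 0 < Module.finrank ℂ QU by omega)
  obtain ⟨X₀, hX₀, hΘX₀, hX₀Θ, hX₀c, c₀, hιc₀, -, hX₀c0⟩ :=
    UnitaryLeviFull.exists_raise_commute_apply_ne_zero hbr hirr hΘ hΘΘ hQ hιmem hιι hιΘ hUm hUp
      ⟨p, fun h => hp0 (Subtype.ext h), ((hPU p).1 hp).1, ((hPU p).1 hp).2⟩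
      ⟨q, fun h => hq0 (Subtype.ext h), ((hQU q).1 hq).1, ((hQU q).1 hq).2⟩
  have hX₀i : Module.finrank ℂ (Up.map X₀) ≠ 0 := fun h0 => by
    have hmem : X₀ c₀ ∈ Up.map X₀ := Submodule.mem_map_of_mem ((hUp c₀).2 hιc₀)
    rw [Submodule.finrank_eq_zero.1 h0, Submodule.mem_bot] at hmem
    exact hX₀c0 hmem
  have hp0 := hprof X₀ hX₀ hΘX₀ hX₀Θ hX₀c
  omega

/-- `(32 | 35)`, minimal rank `25`: `L⁺` of type `(7 | 25)` is full and a lift with `i = 1` has no feasible `j`. [cite: Ribet1983, Thm. 3] [cite: Gordon1997, Thm. 6.3 (3)]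
[cite: Deligne1982HodgeCycles, I §3 Prop. 3.4, 3.6] [cite: GoodmanWallachGTM255, §4.1.1] -/
theorem UnitaryThirtyTwoThirtyFive.no_minRank_25 [FiniteDimensional ℂ W] {𝔊 : Submodule ℂ (Module.End ℂ W)}
    (hbr : ∀ Y ∈ 𝔊, ∀ Z ∈ 𝔊, Y * Z - Z * Y ∈ 𝔊)
    (hirr : ∀ U : Submodule ℂ W, (∀ A ∈ 𝔊, ∀ u ∈ U, A u ∈ U) → U = ⊥ ∨ U = ⊤)
    {Θ : Module.End ℂ W} (hΘ : Θ ∈ 𝔊) (hΘΘ : Θ * Θ = 1)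
    {P Q : Submodule ℂ W} (hP : ∀ x, x ∈ P ↔ Θ x = x) (hQ : ∀ x, x ∈ Q ↔ Θ x = -x)
    (hP32 : Module.finrank ℂ P = 32) (hQ35 : Module.finrank ℂ Q = 35)
    {s : W → W → ℂ} (hadd : ∀ x y z, s (x + y) z = s x z + s y z)
    (hsmul : ∀ (c : ℂ) (x y : W), s (c • x) y = c * s x y) (hsymm : ∀ x y, s y x = starRingEnd ℂ (s x y))
    (hPQ : ∀ p ∈ P, ∀ q ∈ Q, s p q = 0) (hdefP : ∀ p ∈ P, s p p = 0 → p = 0) (hdefQ : ∀ q ∈ Q, s q q = 0 → q = 0)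
    (hadj : ∀ X ∈ 𝔊, ∃ Y ∈ 𝔊, ∀ x y, s (X x) y = s x (Y y))
    (hS : ∀ B' ∈ 𝔊, Θ * B' = B' → B' * Θ = -B' →
      Module.finrank ℂ (LinearMap.range B') = 0 ∨ Module.finrank ℂ (LinearMap.range B') = 25 ∨ Module.finrank ℂ (LinearMap.range B') = 26 ∨ Module.finrank ℂ (LinearMap.range B') = 27 ∨ Module.finrank ℂ (LinearMap.range B') = 28 ∨ Module.finrank ℂ (LinearMap.range B') = 30)
    {B : Module.End ℂ W} (hB : B ∈ 𝔊) (hΘB : Θ * B = B) (hBΘ : B * Θ = -B)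
    (hr : Module.finrank ℂ (LinearMap.range B) = 25) : False := by
  classical
  have hsU : ∀ U : Submodule ℂ W, ∀ x y z : U, s ((x + y : U) : W) z = s (x : W) z + s (y : W) z :=
    fun U x y z => by simp only [Submodule.coe_add, hadd]
  have hsmU : ∀ U : Submodule ℂ W, ∀ (c : ℂ) (x y : U), s ((c • x : U) : W) y = c * s (x : W) y :=
    fun U c x y => by simp only [Submodule.coe_smul, hsmul]
  have hno1 : ∀ B' ∈ 𝔊, Θ * B' = B' → B' * Θ = -B' → Module.finrank ℂ (LinearMap.range B') ≠ 1 := by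
    intro B' hB' hΘB' hB'Θ h1
    rcases hS B' hB' hΘB' hB'Θ with h | h | h | h | h | h <;> omega
  have hmin : ∀ Y ∈ 𝔊, Θ * Y = Y → Y * Θ = -Y → Y ≠ 0 → 25 ≤ Module.finrank ℂ (LinearMap.range Y) := by
    intro Y hY hΘY hYΘ hY0
    have h0 : Module.finrank ℂ (LinearMap.range Y) ≠ 0 := fun h =>
      hY0 (LinearMap.range_eq_bot.1 (Submodule.finrank_eq_zero.1 h))
    rcases hS Y hY hΘY hYΘ with h | h | h | h | h | h <;> omega
  have hmin' : ∀ Z ∈ 𝔊, Θ * Z = Z → Z * Θ = -Z → Z ≠ 0 → Module.finrank ℂ (LinearMap.range B) ≤ Module.finrank ℂ (LinearMap.range Z) := by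
    rw [hr]; exact hmin
  obtain ⟨ι, Um, Up, PU, QU, Lm, ιm, Pm, Qm, Lp, ιp, Pp, Qp, hιmem, hιι, hιΘ, hιs, hUm, hUp, hfinUm, hfinUp,
    hPM, hQM, hPU, hQU, hrangeP, hPUP, hQUQ, hfinQM, hfinPU, hfinQU, hLm, hLp,
    hιmapply, hPmmem, hQmmem, hbrLm, hirrLm, hιmmem, hιmιm, hPm, hQm, hfinPm, hfinQm, hPmQm, hdefPm, hdefQm, hadjLm,
    hιpapply, hPpmem, hQpmem, hbrLp, hirrLp, hιpmem, hιpιp, hPp, hQp, hfinPp, hfinQp, hPpQp, hdefPp, hdefQp, hadjLp,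
    hsplit⟩ :=
    UnitaryLeviSetup.exists_levi_pair hbr hirr hΘ hΘΘ hP hQ hadd hsymm hPQ hdefP hdefQ hadj hB hΘB hBΘ
  have hdich : ∀ X ∈ 𝔊, Θ * X = X → X * Θ = -X → X * ι = ι * X →
      Module.finrank ℂ (Up.map X) + Module.finrank ℂ (Um.map X) ≤ Module.finrank ℂ (LinearMap.range B) ∨
        (25 ≤ Module.finrank ℂ (Up.map X) ∧ 25 ≤ Module.finrank ℂ (Um.map X)) := fun X hX hΘX hXΘ hXc =>
    UnitaryLeviSetup.profile_dichotomy hbr hΘΘ hP hQ hadd hsymm hPQ hdefP hdefQ hadj hmin hB hΘB hBΘ hιι hιΘ hιs hUm hUp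
      hPM hQM hQU hfinQU hrangeP hX hΘX hXΘ hXc
  have hfinQU' := hfinQU
  rw [hr] at hfinQM hfinPU hfinQU hfinPm hfinQm hfinPp hfinQp hsplit hdich
  rw [hQ35] at hfinQM hfinQm hfinUm
  rw [hP32] at hfinPU hfinPp hfinUp
  have hcm : ∀ Z : Module.End ℂ W, Z * ι = ι * Z → ∀ x ∈ Um, Z x ∈ Um := fun Z hZ x hx =>
    (hUm _).2 (by rw [← Module.End.mul_apply, ← hZ, Module.End.mul_apply, (hUm x).1 hx, map_neg])
  have hcp : ∀ Z : Module.End ℂ W, Z * ι = ι * Z → ∀ x ∈ Up, Z x ∈ Up := fun Z hZ x hx =>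
    (hUp _).2 (by rw [← Module.End.mul_apply, ← hZ, Module.End.mul_apply, (hUp x).1 hx])
  have hfullm_of : Lm = ⊤ → False := fun h =>
    UnitaryLeviSetup.false_of_full_larger hbr hΘΘ hno1 hιι hιΘ hUm hUp (by omega) (by omega) hPM hQM (by omega)
      (by omega) hLm h
  have hLptop : Lp = ⊤ :=
    UnitarySeven.eq_top_of_smul hbrLp hirrLp hιpmem hιpιp hPp hQp (by omega) (by omega) (s := fun x y : Up => s (x : W) y) (fun x y z => by simp only [Submodule.coe_add, hadd]) (fun c x y => by simp only [Submodule.coe_smul, hsmul]) (fun x y => hsymm _ _) hPpQp hdefPp hdefQp hadjLp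
  obtain ⟨T1, hιT1, hT1ι, hT1r⟩ := UnitaryRaisingSpace.exists_raise_finrank_range_eq hιpιp hPp hQp (k := 1)
    (by omega) (by omega)
  obtain ⟨X1, hX1, hΘX1, hX1Θ, hX1c, hX1Up⟩ := UnitaryLeviSetup.exists_lift hbr hΘ hΘΘ hcp hιΘ hLp hιpapply T1
    (by rw [hLptop]; exact Submodule.mem_top) hιT1 hT1ι
  rw [hT1r] at hX1Up
  obtain ⟨hs1, hi1, hi1', hj1, hj1'⟩ := hsplit X1 hΘX1 hX1Θ hX1c
  have hrk1 := hS X1 hX1 hΘX1 hX1Θ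
  have hd1 := hdich X1 hX1 hΘX1 hX1Θ hX1c
  rw [hs1] at hrk1
  rw [hX1Up] at hrk1 hd1
  omega

/-- `(32 | 35)`, minimal rank `26`: after the Levi kills every profile has `i = 0` (profiles [(0, 0)]), against the non-vanishing lemma. [cite: Ribet1983, Thm. 3] [cite: Gordon1997, Thm. 6.3 (3)]
[cite: Deligne1982HodgeCycles, I §3 Prop. 3.4, 3.6] [cite: GoodmanWallachGTM255, §4.1.1] -/
theorem UnitaryThirtyTwoThirtyFive.no_minRank_26 [FiniteDimensional ℂ W] {𝔊 : Submodule ℂ (Module.End ℂ W)}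
    (hbr : ∀ Y ∈ 𝔊, ∀ Z ∈ 𝔊, Y * Z - Z * Y ∈ 𝔊)
    (hirr : ∀ U : Submodule ℂ W, (∀ A ∈ 𝔊, ∀ u ∈ U, A u ∈ U) → U = ⊥ ∨ U = ⊤)
    {Θ : Module.End ℂ W} (hΘ : Θ ∈ 𝔊) (hΘΘ : Θ * Θ = 1)
    {P Q : Submodule ℂ W} (hP : ∀ x, x ∈ P ↔ Θ x = x) (hQ : ∀ x, x ∈ Q ↔ Θ x = -x)
    (hP32 : Module.finrank ℂ P = 32) (hQ35 : Module.finrank ℂ Q = 35)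
    {s : W → W → ℂ} (hadd : ∀ x y z, s (x + y) z = s x z + s y z)
    (hsmul : ∀ (c : ℂ) (x y : W), s (c • x) y = c * s x y) (hsymm : ∀ x y, s y x = starRingEnd ℂ (s x y))
    (hPQ : ∀ p ∈ P, ∀ q ∈ Q, s p q = 0) (hdefP : ∀ p ∈ P, s p p = 0 → p = 0) (hdefQ : ∀ q ∈ Q, s q q = 0 → q = 0)
    (hadj : ∀ X ∈ 𝔊, ∃ Y ∈ 𝔊, ∀ x y, s (X x) y = s x (Y y))
    (hS : ∀ B' ∈ 𝔊, Θ * B' = B' → B' * Θ = -B' →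
      Module.finrank ℂ (LinearMap.range B') = 0 ∨ Module.finrank ℂ (LinearMap.range B') = 26 ∨ Module.finrank ℂ (LinearMap.range B') = 27 ∨ Module.finrank ℂ (LinearMap.range B') = 28 ∨ Module.finrank ℂ (LinearMap.range B') = 30)
    {B : Module.End ℂ W} (hB : B ∈ 𝔊) (hΘB : Θ * B = B) (hBΘ : B * Θ = -B)
    (hr : Module.finrank ℂ (LinearMap.range B) = 26) : False := by
  classical
  have hsU : ∀ U : Submodule ℂ W, ∀ x y z : U, s ((x + y : U) : W) z = s (x : W) z + s (y : W) z :=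
    fun U x y z => by simp only [Submodule.coe_add, hadd]
  have hsmU : ∀ U : Submodule ℂ W, ∀ (c : ℂ) (x y : U), s ((c • x : U) : W) y = c * s (x : W) y :=
    fun U c x y => by simp only [Submodule.coe_smul, hsmul]
  have hno1 : ∀ B' ∈ 𝔊, Θ * B' = B' → B' * Θ = -B' → Module.finrank ℂ (LinearMap.range B') ≠ 1 := by
    intro B' hB' hΘB' hB'Θ h1
    rcases hS B' hB' hΘB' hB'Θ with h | h | h | h | h <;> omega
  have hmin : ∀ Y ∈ 𝔊, Θ * Y = Y → Y * Θ = -Y → Y ≠ 0 → 26 ≤ Module.finrank ℂ (LinearMap.range Y) := by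
    intro Y hY hΘY hYΘ hY0
    have h0 : Module.finrank ℂ (LinearMap.range Y) ≠ 0 := fun h =>
      hY0 (LinearMap.range_eq_bot.1 (Submodule.finrank_eq_zero.1 h))
    rcases hS Y hY hΘY hYΘ with h | h | h | h | h <;> omega
  have hmin' : ∀ Z ∈ 𝔊, Θ * Z = Z → Z * Θ = -Z → Z ≠ 0 → Module.finrank ℂ (LinearMap.range B) ≤ Module.finrank ℂ (LinearMap.range Z) := by
    rw [hr]; exact hmin
  obtain ⟨ι, Um, Up, PU, QU, Lm, ιm, Pm, Qm, Lp, ιp, Pp, Qp, hιmem, hιι, hιΘ, hιs, hUm, hUp, hfinUm, hfinUp,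
    hPM, hQM, hPU, hQU, hrangeP, hPUP, hQUQ, hfinQM, hfinPU, hfinQU, hLm, hLp,
    hιmapply, hPmmem, hQmmem, hbrLm, hirrLm, hιmmem, hιmιm, hPm, hQm, hfinPm, hfinQm, hPmQm, hdefPm, hdefQm, hadjLm,
    hιpapply, hPpmem, hQpmem, hbrLp, hirrLp, hιpmem, hιpιp, hPp, hQp, hfinPp, hfinQp, hPpQp, hdefPp, hdefQp, hadjLp,
    hsplit⟩ :=
    UnitaryLeviSetup.exists_levi_pair hbr hirr hΘ hΘΘ hP hQ hadd hsymm hPQ hdefP hdefQ hadj hB hΘB hBΘ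
  have hdich : ∀ X ∈ 𝔊, Θ * X = X → X * Θ = -X → X * ι = ι * X →
      Module.finrank ℂ (Up.map X) + Module.finrank ℂ (Um.map X) ≤ Module.finrank ℂ (LinearMap.range B) ∨
        (26 ≤ Module.finrank ℂ (Up.map X) ∧ 26 ≤ Module.finrank ℂ (Um.map X)) := fun X hX hΘX hXΘ hXc =>
    UnitaryLeviSetup.profile_dichotomy hbr hΘΘ hP hQ hadd hsymm hPQ hdefP hdefQ hadj hmin hB hΘB hBΘ hιι hιΘ hιs hUm hUp
      hPM hQM hQU hfinQU hrangeP hX hΘX hXΘ hXc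
  have hfinQU' := hfinQU
  rw [hr] at hfinQM hfinPU hfinQU hfinPm hfinQm hfinPp hfinQp hsplit hdich
  rw [hQ35] at hfinQM hfinQm hfinUm
  rw [hP32] at hfinPU hfinPp hfinUp
  have hcm : ∀ Z : Module.End ℂ W, Z * ι = ι * Z → ∀ x ∈ Um, Z x ∈ Um := fun Z hZ x hx =>
    (hUm _).2 (by rw [← Module.End.mul_apply, ← hZ, Module.End.mul_apply, (hUm x).1 hx, map_neg])
  have hcp : ∀ Z : Module.End ℂ W, Z * ι = ι * Z → ∀ x ∈ Up, Z x ∈ Up := fun Z hZ x hx =>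
    (hUp _).2 (by rw [← Module.End.mul_apply, ← hZ, Module.End.mul_apply, (hUp x).1 hx])
  have hfullm_of : Lm = ⊤ → False := fun h =>
    UnitaryLeviSetup.false_of_full_larger hbr hΘΘ hno1 hιι hιΘ hUm hUp (by omega) (by omega) hPM hQM (by omega)
      (by omega) hLm h
  have hfullp_of : Lp = ⊤ → False := by
    intro hLptop
    obtain ⟨T1, hιT1, hT1ι, hT1r⟩ := UnitaryRaisingSpace.exists_raise_finrank_range_eq hιpιp hPp hQp (k := 1)
      (by omega) (by omega)
    obtain ⟨X1, hX1, hΘX1, hX1Θ, hX1c, hX1Up⟩ := UnitaryLeviSetup.exists_lift hbr hΘ hΘΘ hcp hιΘ hLp hιpapply T1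
      (by rw [hLptop]; exact Submodule.mem_top) hιT1 hT1ι
    rw [hT1r] at hX1Up
    obtain ⟨hs1, hi1, hi1', hj1, hj1'⟩ := hsplit X1 hΘX1 hX1Θ hX1c
    have hrk1 := hS X1 hX1 hΘX1 hX1Θ
    have hd1 := hdich X1 hX1 hΘX1 hX1Θ hX1c
    rw [hs1] at hrk1
    rw [hX1Up] at hrk1 hd1
    omega
  have hprof : ∀ X ∈ 𝔊, Θ * X = X → X * Θ = -X → X * ι = ι * X →
      (Module.finrank ℂ (Up.map X) = 0 ∧ Module.finrank ℂ (Um.map X) = 0) := by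
    intro X hX hΘX hXΘ hXc
    obtain ⟨hs, hi, hi', hj, hj'⟩ := hsplit X hΘX hXΘ hXc

    have hrk := hS X hX hΘX hXΘ
    have hd := hdich X hX hΘX hXΘ hXc
    rw [hs] at hrk
    generalize Module.finrank ℂ ↥(Submodule.map X Um) = jj at *
    have hjle : jj ≤ 9 := by omega
    interval_cases jj
    · exact ⟨by omega, rfl⟩
    · exfalso; omega
    · exfalso; omega
    · exfalso; omega
    · exfalso; omega
    · exfalso; omega
    · exfalso; omega
    · exfalso; omega
    · exfalso; omega
    · exfalso; omega
  obtain ⟨⟨p, hp⟩, hp0⟩ := Module.finrank_pos_iff_exists_ne_zero.1 (show 0 < Module.finrank ℂ PU by omega)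
  obtain ⟨⟨q, hq⟩, hq0⟩ := Module.finrank_pos_iff_exists_ne_zero.1 (show 0 < Module.finrank ℂ QU by omega)
  obtain ⟨X₀, hX₀, hΘX₀, hX₀Θ, hX₀c, c₀, hιc₀, -, hX₀c0⟩ :=
    UnitaryLeviFull.exists_raise_commute_apply_ne_zero hbr hirr hΘ hΘΘ hQ hιmem hιι hιΘ hUm hUp
      ⟨p, fun h => hp0 (Subtype.ext h), ((hPU p).1 hp).1, ((hPU p).1 hp).2⟩
      ⟨q, fun h => hq0 (Subtype.ext h), ((hQU q).1 hq).1, ((hQU q).1 hq).2⟩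
  have hX₀i : Module.finrank ℂ (Up.map X₀) ≠ 0 := fun h0 => by
    have hmem : X₀ c₀ ∈ Up.map X₀ := Submodule.mem_map_of_mem ((hUp c₀).2 hιc₀)
    rw [Submodule.finrank_eq_zero.1 h0, Submodule.mem_bot] at hmem
    exact hX₀c0 hmem
  have hp0 := hprof X₀ hX₀ hΘX₀ hX₀Θ hX₀c
  omega

/-- `(32 | 35)`, minimal rank `27`: `L⁺` of type `(5 | 27)` is full and a lift with `i = 1` has no feasible `j`. [cite: Ribet1983, Thm. 3] [cite: Gordon1997, Thm. 6.3 (3)]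
[cite: Deligne1982HodgeCycles, I §3 Prop. 3.4, 3.6] [cite: GoodmanWallachGTM255, §4.1.1] -/
theorem UnitaryThirtyTwoThirtyFive.no_minRank_27 [FiniteDimensional ℂ W] {𝔊 : Submodule ℂ (Module.End ℂ W)}
    (hbr : ∀ Y ∈ 𝔊, ∀ Z ∈ 𝔊, Y * Z - Z * Y ∈ 𝔊)
    (hirr : ∀ U : Submodule ℂ W, (∀ A ∈ 𝔊, ∀ u ∈ U, A u ∈ U) → U = ⊥ ∨ U = ⊤)
    {Θ : Module.End ℂ W} (hΘ : Θ ∈ 𝔊) (hΘΘ : Θ * Θ = 1)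
    {P Q : Submodule ℂ W} (hP : ∀ x, x ∈ P ↔ Θ x = x) (hQ : ∀ x, x ∈ Q ↔ Θ x = -x)
    (hP32 : Module.finrank ℂ P = 32) (hQ35 : Module.finrank ℂ Q = 35)
    {s : W → W → ℂ} (hadd : ∀ x y z, s (x + y) z = s x z + s y z)
    (hsmul : ∀ (c : ℂ) (x y : W), s (c • x) y = c * s x y) (hsymm : ∀ x y, s y x = starRingEnd ℂ (s x y))
    (hPQ : ∀ p ∈ P, ∀ q ∈ Q, s p q = 0) (hdefP : ∀ p ∈ P, s p p = 0 → p = 0) (hdefQ : ∀ q ∈ Q, s q q = 0 → q = 0)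
    (hadj : ∀ X ∈ 𝔊, ∃ Y ∈ 𝔊, ∀ x y, s (X x) y = s x (Y y))
    (hS : ∀ B' ∈ 𝔊, Θ * B' = B' → B' * Θ = -B' →
      Module.finrank ℂ (LinearMap.range B') = 0 ∨ Module.finrank ℂ (LinearMap.range B') = 27 ∨ Module.finrank ℂ (LinearMap.range B') = 28 ∨ Module.finrank ℂ (LinearMap.range B') = 30)
    {B : Module.End ℂ W} (hB : B ∈ 𝔊) (hΘB : Θ * B = B) (hBΘ : B * Θ = -B)
    (hr : Module.finrank ℂ (LinearMap.range B) = 27) : False := by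
  classical
  have hsU : ∀ U : Submodule ℂ W, ∀ x y z : U, s ((x + y : U) : W) z = s (x : W) z + s (y : W) z :=
    fun U x y z => by simp only [Submodule.coe_add, hadd]
  have hsmU : ∀ U : Submodule ℂ W, ∀ (c : ℂ) (x y : U), s ((c • x : U) : W) y = c * s (x : W) y :=
    fun U c x y => by simp only [Submodule.coe_smul, hsmul]
  have hno1 : ∀ B' ∈ 𝔊, Θ * B' = B' → B' * Θ = -B' → Module.finrank ℂ (LinearMap.range B') ≠ 1 := by
    intro B' hB' hΘB' hB'Θ h1
    rcases hS B' hB' hΘB' hB'Θ with h | h | h | h <;> omega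
  have hmin : ∀ Y ∈ 𝔊, Θ * Y = Y → Y * Θ = -Y → Y ≠ 0 → 27 ≤ Module.finrank ℂ (LinearMap.range Y) := by
    intro Y hY hΘY hYΘ hY0
    have h0 : Module.finrank ℂ (LinearMap.range Y) ≠ 0 := fun h =>
      hY0 (LinearMap.range_eq_bot.1 (Submodule.finrank_eq_zero.1 h))
    rcases hS Y hY hΘY hYΘ with h | h | h | h <;> omega
  have hmin' : ∀ Z ∈ 𝔊, Θ * Z = Z → Z * Θ = -Z → Z ≠ 0 → Module.finrank ℂ (LinearMap.range B) ≤ Module.finrank ℂ (LinearMap.range Z) := by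
    rw [hr]; exact hmin
  obtain ⟨ι, Um, Up, PU, QU, Lm, ιm, Pm, Qm, Lp, ιp, Pp, Qp, hιmem, hιι, hιΘ, hιs, hUm, hUp, hfinUm, hfinUp,
    hPM, hQM, hPU, hQU, hrangeP, hPUP, hQUQ, hfinQM, hfinPU, hfinQU, hLm, hLp,
    hιmapply, hPmmem, hQmmem, hbrLm, hirrLm, hιmmem, hιmιm, hPm, hQm, hfinPm, hfinQm, hPmQm, hdefPm, hdefQm, hadjLm,
    hιpapply, hPpmem, hQpmem, hbrLp, hirrLp, hιpmem, hιpιp, hPp, hQp, hfinPp, hfinQp, hPpQp, hdefPp, hdefQp, hadjLp,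
    hsplit⟩ :=
    UnitaryLeviSetup.exists_levi_pair hbr hirr hΘ hΘΘ hP hQ hadd hsymm hPQ hdefP hdefQ hadj hB hΘB hBΘ
  have hdich : ∀ X ∈ 𝔊, Θ * X = X → X * Θ = -X → X * ι = ι * X →
      Module.finrank ℂ (Up.map X) + Module.finrank ℂ (Um.map X) ≤ Module.finrank ℂ (LinearMap.range B) ∨
        (27 ≤ Module.finrank ℂ (Up.map X) ∧ 27 ≤ Module.finrank ℂ (Um.map X)) := fun X hX hΘX hXΘ hXc =>
    UnitaryLeviSetup.profile_dichotomy hbr hΘΘ hP hQ hadd hsymm hPQ hdefP hdefQ hadj hmin hB hΘB hBΘ hιι hιΘ hιs hUm hUp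
      hPM hQM hQU hfinQU hrangeP hX hΘX hXΘ hXc
  have hfinQU' := hfinQU
  rw [hr] at hfinQM hfinPU hfinQU hfinPm hfinQm hfinPp hfinQp hsplit hdich
  rw [hQ35] at hfinQM hfinQm hfinUm
  rw [hP32] at hfinPU hfinPp hfinUp
  have hcm : ∀ Z : Module.End ℂ W, Z * ι = ι * Z → ∀ x ∈ Um, Z x ∈ Um := fun Z hZ x hx =>
    (hUm _).2 (by rw [← Module.End.mul_apply, ← hZ, Module.End.mul_apply, (hUm x).1 hx, map_neg])
  have hcp : ∀ Z : Module.End ℂ W, Z * ι = ι * Z → ∀ x ∈ Up, Z x ∈ Up := fun Z hZ x hx =>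
    (hUp _).2 (by rw [← Module.End.mul_apply, ← hZ, Module.End.mul_apply, (hUp x).1 hx])
  have hfullm_of : Lm = ⊤ → False := fun h =>
    UnitaryLeviSetup.false_of_full_larger hbr hΘΘ hno1 hιι hιΘ hUm hUp (by omega) (by omega) hPM hQM (by omega)
      (by omega) hLm h
  have hLptop : Lp = ⊤ :=
    UnitaryFive.eq_top_of_smul hbrLp hirrLp hιpmem hιpιp hPp hQp (by omega) (by omega) (s := fun x y : Up => s (x : W) y) (fun x y z => by simp only [Submodule.coe_add, hadd]) (fun c x y => by simp only [Submodule.coe_smul, hsmul]) (fun x y => hsymm _ _) hPpQp hdefPp hdefQp hadjLp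
  obtain ⟨T1, hιT1, hT1ι, hT1r⟩ := UnitaryRaisingSpace.exists_raise_finrank_range_eq hιpιp hPp hQp (k := 1)
    (by omega) (by omega)
  obtain ⟨X1, hX1, hΘX1, hX1Θ, hX1c, hX1Up⟩ := UnitaryLeviSetup.exists_lift hbr hΘ hΘΘ hcp hιΘ hLp hιpapply T1
    (by rw [hLptop]; exact Submodule.mem_top) hιT1 hT1ι
  rw [hT1r] at hX1Up
  obtain ⟨hs1, hi1, hi1', hj1, hj1'⟩ := hsplit X1 hΘX1 hX1Θ hX1c
  have hrk1 := hS X1 hX1 hΘX1 hX1Θ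
  have hd1 := hdich X1 hX1 hΘX1 hX1Θ hX1c
  rw [hs1] at hrk1
  rw [hX1Up] at hrk1 hd1
  omega

/-- `(32 | 35)`, minimal rank `28`: after the Levi kills every profile has `i = 0` (profiles [(0, 0)]), against the non-vanishing lemma. [cite: Ribet1983, Thm. 3] [cite: Gordon1997, Thm. 6.3 (3)]
[cite: Deligne1982HodgeCycles, I §3 Prop. 3.4, 3.6] [cite: GoodmanWallachGTM255, §4.1.1] -/
theorem UnitaryThirtyTwoThirtyFive.no_minRank_28 [FiniteDimensional ℂ W] {𝔊 : Submodule ℂ (Module.End ℂ W)}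
    (hbr : ∀ Y ∈ 𝔊, ∀ Z ∈ 𝔊, Y * Z - Z * Y ∈ 𝔊)
    (hirr : ∀ U : Submodule ℂ W, (∀ A ∈ 𝔊, ∀ u ∈ U, A u ∈ U) → U = ⊥ ∨ U = ⊤)
    {Θ : Module.End ℂ W} (hΘ : Θ ∈ 𝔊) (hΘΘ : Θ * Θ = 1)
    {P Q : Submodule ℂ W} (hP : ∀ x, x ∈ P ↔ Θ x = x) (hQ : ∀ x, x ∈ Q ↔ Θ x = -x)
    (hP32 : Module.finrank ℂ P = 32) (hQ35 : Module.finrank ℂ Q = 35)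
    {s : W → W → ℂ} (hadd : ∀ x y z, s (x + y) z = s x z + s y z)
    (hsmul : ∀ (c : ℂ) (x y : W), s (c • x) y = c * s x y) (hsymm : ∀ x y, s y x = starRingEnd ℂ (s x y))
    (hPQ : ∀ p ∈ P, ∀ q ∈ Q, s p q = 0) (hdefP : ∀ p ∈ P, s p p = 0 → p = 0) (hdefQ : ∀ q ∈ Q, s q q = 0 → q = 0)
    (hadj : ∀ X ∈ 𝔊, ∃ Y ∈ 𝔊, ∀ x y, s (X x) y = s x (Y y))
    (hS : ∀ B' ∈ 𝔊, Θ * B' = B' → B' * Θ = -B' →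
      Module.finrank ℂ (LinearMap.range B') = 0 ∨ Module.finrank ℂ (LinearMap.range B') = 28 ∨ Module.finrank ℂ (LinearMap.range B') = 30)
    {B : Module.End ℂ W} (hB : B ∈ 𝔊) (hΘB : Θ * B = B) (hBΘ : B * Θ = -B)
    (hr : Module.finrank ℂ (LinearMap.range B) = 28) : False := by
  classical
  have hsU : ∀ U : Submodule ℂ W, ∀ x y z : U, s ((x + y : U) : W) z = s (x : W) z + s (y : W) z :=
    fun U x y z => by simp only [Submodule.coe_add, hadd]
  have hsmU : ∀ U : Submodule ℂ W, ∀ (c : ℂ) (x y : U), s ((c • x : U) : W) y = c * s (x : W) y :=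
    fun U c x y => by simp only [Submodule.coe_smul, hsmul]
  have hno1 : ∀ B' ∈ 𝔊, Θ * B' = B' → B' * Θ = -B' → Module.finrank ℂ (LinearMap.range B') ≠ 1 := by
    intro B' hB' hΘB' hB'Θ h1
    rcases hS B' hB' hΘB' hB'Θ with h | h | h <;> omega
  have hmin : ∀ Y ∈ 𝔊, Θ * Y = Y → Y * Θ = -Y → Y ≠ 0 → 28 ≤ Module.finrank ℂ (LinearMap.range Y) := by
    intro Y hY hΘY hYΘ hY0
    have h0 : Module.finrank ℂ (LinearMap.range Y) ≠ 0 := fun h =>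
      hY0 (LinearMap.range_eq_bot.1 (Submodule.finrank_eq_zero.1 h))
    rcases hS Y hY hΘY hYΘ with h | h | h <;> omega
  have hmin' : ∀ Z ∈ 𝔊, Θ * Z = Z → Z * Θ = -Z → Z ≠ 0 → Module.finrank ℂ (LinearMap.range B) ≤ Module.finrank ℂ (LinearMap.range Z) := by
    rw [hr]; exact hmin
  obtain ⟨ι, Um, Up, PU, QU, Lm, ιm, Pm, Qm, Lp, ιp, Pp, Qp, hιmem, hιι, hιΘ, hιs, hUm, hUp, hfinUm, hfinUp,
    hPM, hQM, hPU, hQU, hrangeP, hPUP, hQUQ, hfinQM, hfinPU, hfinQU, hLm, hLp,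
    hιmapply, hPmmem, hQmmem, hbrLm, hirrLm, hιmmem, hιmιm, hPm, hQm, hfinPm, hfinQm, hPmQm, hdefPm, hdefQm, hadjLm,
    hιpapply, hPpmem, hQpmem, hbrLp, hirrLp, hιpmem, hιpιp, hPp, hQp, hfinPp, hfinQp, hPpQp, hdefPp, hdefQp, hadjLp,
    hsplit⟩ :=
    UnitaryLeviSetup.exists_levi_pair hbr hirr hΘ hΘΘ hP hQ hadd hsymm hPQ hdefP hdefQ hadj hB hΘB hBΘ
  have hdich : ∀ X ∈ 𝔊, Θ * X = X → X * Θ = -X → X * ι = ι * X →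
      Module.finrank ℂ (Up.map X) + Module.finrank ℂ (Um.map X) ≤ Module.finrank ℂ (LinearMap.range B) ∨
        (28 ≤ Module.finrank ℂ (Up.map X) ∧ 28 ≤ Module.finrank ℂ (Um.map X)) := fun X hX hΘX hXΘ hXc =>
    UnitaryLeviSetup.profile_dichotomy hbr hΘΘ hP hQ hadd hsymm hPQ hdefP hdefQ hadj hmin hB hΘB hBΘ hιι hιΘ hιs hUm hUp
      hPM hQM hQU hfinQU hrangeP hX hΘX hXΘ hXc
  have hfinQU' := hfinQU
  rw [hr] at hfinQM hfinPU hfinQU hfinPm hfinQm hfinPp hfinQp hsplit hdich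
  rw [hQ35] at hfinQM hfinQm hfinUm
  rw [hP32] at hfinPU hfinPp hfinUp
  have hcm : ∀ Z : Module.End ℂ W, Z * ι = ι * Z → ∀ x ∈ Um, Z x ∈ Um := fun Z hZ x hx =>
    (hUm _).2 (by rw [← Module.End.mul_apply, ← hZ, Module.End.mul_apply, (hUm x).1 hx, map_neg])
  have hcp : ∀ Z : Module.End ℂ W, Z * ι = ι * Z → ∀ x ∈ Up, Z x ∈ Up := fun Z hZ x hx =>
    (hUp _).2 (by rw [← Module.End.mul_apply, ← hZ, Module.End.mul_apply, (hUp x).1 hx])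
  have hfullm_of : Lm = ⊤ → False := fun h =>
    UnitaryLeviSetup.false_of_full_larger hbr hΘΘ hno1 hιι hιΘ hUm hUp (by omega) (by omega) hPM hQM (by omega)
      (by omega) hLm h
  have hfullp_of : Lp = ⊤ → False := by
    intro hLptop
    obtain ⟨T1, hιT1, hT1ι, hT1r⟩ := UnitaryRaisingSpace.exists_raise_finrank_range_eq hιpιp hPp hQp (k := 1)
      (by omega) (by omega)
    obtain ⟨X1, hX1, hΘX1, hX1Θ, hX1c, hX1Up⟩ := UnitaryLeviSetup.exists_lift hbr hΘ hΘΘ hcp hιΘ hLp hιpapply T1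
      (by rw [hLptop]; exact Submodule.mem_top) hιT1 hT1ι
    rw [hT1r] at hX1Up
    obtain ⟨hs1, hi1, hi1', hj1, hj1'⟩ := hsplit X1 hΘX1 hX1Θ hX1c
    have hrk1 := hS X1 hX1 hΘX1 hX1Θ
    have hd1 := hdich X1 hX1 hΘX1 hX1Θ hX1c
    rw [hs1] at hrk1
    rw [hX1Up] at hrk1 hd1
    omega
  have hprof : ∀ X ∈ 𝔊, Θ * X = X → X * Θ = -X → X * ι = ι * X →
      (Module.finrank ℂ (Up.map X) = 0 ∧ Module.finrank ℂ (Um.map X) = 0) := by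
    intro X hX hΘX hXΘ hXc
    obtain ⟨hs, hi, hi', hj, hj'⟩ := hsplit X hΘX hXΘ hXc

    have hrk := hS X hX hΘX hXΘ
    have hd := hdich X hX hΘX hXΘ hXc
    rw [hs] at hrk
    generalize Module.finrank ℂ ↥(Submodule.map X Um) = jj at *
    have hjle : jj ≤ 7 := by omega
    interval_cases jj
    · exact ⟨by omega, rfl⟩
    · exfalso; omega
    · exfalso; omega
    · exfalso; omega
    · exfalso; omega
    · exfalso; omega
    · exfalso; omega
    · exfalso; omega
  obtain ⟨⟨p, hp⟩, hp0⟩ := Module.finrank_pos_iff_exists_ne_zero.1 (show 0 < Module.finrank ℂ PU by omega)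
  obtain ⟨⟨q, hq⟩, hq0⟩ := Module.finrank_pos_iff_exists_ne_zero.1 (show 0 < Module.finrank ℂ QU by omega)
  obtain ⟨X₀, hX₀, hΘX₀, hX₀Θ, hX₀c, c₀, hιc₀, -, hX₀c0⟩ :=
    UnitaryLeviFull.exists_raise_commute_apply_ne_zero hbr hirr hΘ hΘΘ hQ hιmem hιι hιΘ hUm hUp
      ⟨p, fun h => hp0 (Subtype.ext h), ((hPU p).1 hp).1, ((hPU p).1 hp).2⟩
      ⟨q, fun h => hq0 (Subtype.ext h), ((hQU q).1 hq).1, ((hQU q).1 hq).2⟩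
  have hX₀i : Module.finrank ℂ (Up.map X₀) ≠ 0 := fun h0 => by
    have hmem : X₀ c₀ ∈ Up.map X₀ := Submodule.mem_map_of_mem ((hUp c₀).2 hιc₀)
    rw [Submodule.finrank_eq_zero.1 h0, Submodule.mem_bot] at hmem
    exact hX₀c0 hmem
  have hp0 := hprof X₀ hX₀ hΘX₀ hX₀Θ hX₀c
  omega

/-- `(32 | 35)`, minimal rank `30`: after the Levi kills every profile has `i = 0` (profiles [(0, 0)]), against the non-vanishing lemma. [cite: Ribet1983, Thm. 3] [cite: Gordon1997, Thm. 6.3 (3)]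
[cite: Deligne1982HodgeCycles, I §3 Prop. 3.4, 3.6] [cite: GoodmanWallachGTM255, §4.1.1] -/
theorem UnitaryThirtyTwoThirtyFive.no_minRank_30 [FiniteDimensional ℂ W] {𝔊 : Submodule ℂ (Module.End ℂ W)}
    (hbr : ∀ Y ∈ 𝔊, ∀ Z ∈ 𝔊, Y * Z - Z * Y ∈ 𝔊)
    (hirr : ∀ U : Submodule ℂ W, (∀ A ∈ 𝔊, ∀ u ∈ U, A u ∈ U) → U = ⊥ ∨ U = ⊤)
    {Θ : Module.End ℂ W} (hΘ : Θ ∈ 𝔊) (hΘΘ : Θ * Θ = 1)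
    {P Q : Submodule ℂ W} (hP : ∀ x, x ∈ P ↔ Θ x = x) (hQ : ∀ x, x ∈ Q ↔ Θ x = -x)
    (hP32 : Module.finrank ℂ P = 32) (hQ35 : Module.finrank ℂ Q = 35)
    {s : W → W → ℂ} (hadd : ∀ x y z, s (x + y) z = s x z + s y z)
    (hsmul : ∀ (c : ℂ) (x y : W), s (c • x) y = c * s x y) (hsymm : ∀ x y, s y x = starRingEnd ℂ (s x y))
    (hPQ : ∀ p ∈ P, ∀ q ∈ Q, s p q = 0) (hdefP : ∀ p ∈ P, s p p = 0 → p = 0) (hdefQ : ∀ q ∈ Q, s q q = 0 → q = 0)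
    (hadj : ∀ X ∈ 𝔊, ∃ Y ∈ 𝔊, ∀ x y, s (X x) y = s x (Y y))
    (hS : ∀ B' ∈ 𝔊, Θ * B' = B' → B' * Θ = -B' →
      Module.finrank ℂ (LinearMap.range B') = 0 ∨ Module.finrank ℂ (LinearMap.range B') = 30)
    {B : Module.End ℂ W} (hB : B ∈ 𝔊) (hΘB : Θ * B = B) (hBΘ : B * Θ = -B)
    (hr : Module.finrank ℂ (LinearMap.range B) = 30) : False := by
  classical
  have hsU : ∀ U : Submodule ℂ W, ∀ x y z : U, s ((x + y : U) : W) z = s (x : W) z + s (y : W) z :=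
    fun U x y z => by simp only [Submodule.coe_add, hadd]
  have hsmU : ∀ U : Submodule ℂ W, ∀ (c : ℂ) (x y : U), s ((c • x : U) : W) y = c * s (x : W) y :=
    fun U c x y => by simp only [Submodule.coe_smul, hsmul]
  have hno1 : ∀ B' ∈ 𝔊, Θ * B' = B' → B' * Θ = -B' → Module.finrank ℂ (LinearMap.range B') ≠ 1 := by
    intro B' hB' hΘB' hB'Θ h1
    rcases hS B' hB' hΘB' hB'Θ with h | h <;> omega
  have hmin : ∀ Y ∈ 𝔊, Θ * Y = Y → Y * Θ = -Y → Y ≠ 0 → 30 ≤ Module.finrank ℂ (LinearMap.range Y) := by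
    intro Y hY hΘY hYΘ hY0
    have h0 : Module.finrank ℂ (LinearMap.range Y) ≠ 0 := fun h =>
      hY0 (LinearMap.range_eq_bot.1 (Submodule.finrank_eq_zero.1 h))
    rcases hS Y hY hΘY hYΘ with h | h <;> omega
  have hmin' : ∀ Z ∈ 𝔊, Θ * Z = Z → Z * Θ = -Z → Z ≠ 0 → Module.finrank ℂ (LinearMap.range B) ≤ Module.finrank ℂ (LinearMap.range Z) := by
    rw [hr]; exact hmin
  obtain ⟨ι, Um, Up, PU, QU, Lm, ιm, Pm, Qm, Lp, ιp, Pp, Qp, hιmem, hιι, hιΘ, hιs, hUm, hUp, hfinUm, hfinUp,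
    hPM, hQM, hPU, hQU, hrangeP, hPUP, hQUQ, hfinQM, hfinPU, hfinQU, hLm, hLp,
    hιmapply, hPmmem, hQmmem, hbrLm, hirrLm, hιmmem, hιmιm, hPm, hQm, hfinPm, hfinQm, hPmQm, hdefPm, hdefQm, hadjLm,
    hιpapply, hPpmem, hQpmem, hbrLp, hirrLp, hιpmem, hιpιp, hPp, hQp, hfinPp, hfinQp, hPpQp, hdefPp, hdefQp, hadjLp,
    hsplit⟩ :=
    UnitaryLeviSetup.exists_levi_pair hbr hirr hΘ hΘΘ hP hQ hadd hsymm hPQ hdefP hdefQ hadj hB hΘB hBΘ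
  have hdich : ∀ X ∈ 𝔊, Θ * X = X → X * Θ = -X → X * ι = ι * X →
      Module.finrank ℂ (Up.map X) + Module.finrank ℂ (Um.map X) ≤ Module.finrank ℂ (LinearMap.range B) ∨
        (30 ≤ Module.finrank ℂ (Up.map X) ∧ 30 ≤ Module.finrank ℂ (Um.map X)) := fun X hX hΘX hXΘ hXc =>
    UnitaryLeviSetup.profile_dichotomy hbr hΘΘ hP hQ hadd hsymm hPQ hdefP hdefQ hadj hmin hB hΘB hBΘ hιι hιΘ hιs hUm hUp
      hPM hQM hQU hfinQU hrangeP hX hΘX hXΘ hXc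
  have hfinQU' := hfinQU
  rw [hr] at hfinQM hfinPU hfinQU hfinPm hfinQm hfinPp hfinQp hsplit hdich
  rw [hQ35] at hfinQM hfinQm hfinUm
  rw [hP32] at hfinPU hfinPp hfinUp
  have hcm : ∀ Z : Module.End ℂ W, Z * ι = ι * Z → ∀ x ∈ Um, Z x ∈ Um := fun Z hZ x hx =>
    (hUm _).2 (by rw [← Module.End.mul_apply, ← hZ, Module.End.mul_apply, (hUm x).1 hx, map_neg])
  have hcp : ∀ Z : Module.End ℂ W, Z * ι = ι * Z → ∀ x ∈ Up, Z x ∈ Up := fun Z hZ x hx =>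
    (hUp _).2 (by rw [← Module.End.mul_apply, ← hZ, Module.End.mul_apply, (hUp x).1 hx])
  have hfullm_of : Lm = ⊤ → False := fun h =>
    UnitaryLeviSetup.false_of_full_larger hbr hΘΘ hno1 hιι hιΘ hUm hUp (by omega) (by omega) hPM hQM (by omega)
      (by omega) hLm h
  have hfullp_of : Lp = ⊤ → False := by
    intro hLptop
    obtain ⟨T1, hιT1, hT1ι, hT1r⟩ := UnitaryRaisingSpace.exists_raise_finrank_range_eq hιpιp hPp hQp (k := 1)
      (by omega) (by omega)
    obtain ⟨X1, hX1, hΘX1, hX1Θ, hX1c, hX1Up⟩ := UnitaryLeviSetup.exists_lift hbr hΘ hΘΘ hcp hιΘ hLp hιpapply T1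
      (by rw [hLptop]; exact Submodule.mem_top) hιT1 hT1ι
    rw [hT1r] at hX1Up
    obtain ⟨hs1, hi1, hi1', hj1, hj1'⟩ := hsplit X1 hΘX1 hX1Θ hX1c
    have hrk1 := hS X1 hX1 hΘX1 hX1Θ
    have hd1 := hdich X1 hX1 hΘX1 hX1Θ hX1c
    rw [hs1] at hrk1
    rw [hX1Up] at hrk1 hd1
    omega
  have hprof : ∀ X ∈ 𝔊, Θ * X = X → X * Θ = -X → X * ι = ι * X →
      (Module.finrank ℂ (Up.map X) = 0 ∧ Module.finrank ℂ (Um.map X) = 0) := by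
    intro X hX hΘX hXΘ hXc
    obtain ⟨hs, hi, hi', hj, hj'⟩ := hsplit X hΘX hXΘ hXc

    have hrk := hS X hX hΘX hXΘ
    have hd := hdich X hX hΘX hXΘ hXc
    rw [hs] at hrk
    generalize Module.finrank ℂ ↥(Submodule.map X Um) = jj at *
    have hjle : jj ≤ 5 := by omega
    interval_cases jj
    · exact ⟨by omega, rfl⟩
    · exfalso; omega
    · exfalso; omega
    · exfalso; omega
    · exfalso; omega
    · exfalso; omega
  obtain ⟨⟨p, hp⟩, hp0⟩ := Module.finrank_pos_iff_exists_ne_zero.1 (show 0 < Module.finrank ℂ PU by omega)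
  obtain ⟨⟨q, hq⟩, hq0⟩ := Module.finrank_pos_iff_exists_ne_zero.1 (show 0 < Module.finrank ℂ QU by omega)
  obtain ⟨X₀, hX₀, hΘX₀, hX₀Θ, hX₀c, c₀, hιc₀, -, hX₀c0⟩ :=
    UnitaryLeviFull.exists_raise_commute_apply_ne_zero hbr hirr hΘ hΘΘ hQ hιmem hιι hιΘ hUm hUp
      ⟨p, fun h => hp0 (Subtype.ext h), ((hPU p).1 hp).1, ((hPU p).1 hp).2⟩
      ⟨q, fun h => hq0 (Subtype.ext h), ((hQU q).1 hq).1, ((hQU q).1 hq).2⟩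
  have hX₀i : Module.finrank ℂ (Up.map X₀) ≠ 0 := fun h0 => by
    have hmem : X₀ c₀ ∈ Up.map X₀ := Submodule.mem_map_of_mem ((hUp c₀).2 hιc₀)
    rw [Submodule.finrank_eq_zero.1 h0, Submodule.mem_bot] at hmem
    exact hX₀c0 hmem
  have hp0 := hprof X₀ hX₀ hΘX₀ hX₀Θ hX₀c
  omega


end HodgeStructure

end Literature.AlgebraicGeometry.Motives

end
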